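import Literature.MathematicalPhysics.QuantumFieldTheory.Balaban1983to89.B9SectBGpFrameCodedY
import Literature.MathematicalPhysics.QuantumFieldTheory.Balaban1983to89.B9Thm314WholeExpansionReads
import Literature.MathematicalPhysics.QuantumFieldTheory.Balaban1983to89.B9Ineq349SiteComposite

/-!
# `Balaban1983to89.B9SectBGpReadingsY` — THE conj-`b` READING∕WRITING DICTIONARY between the sup-over-directions block readings of an `𝔸`-valued
# letter on product-form inputs and the block majorants of its real-coordinate conjugate; the AUGMENTED coded reading family `kernelFamilySC`;
# ★★ `Read342Y` and ★★ `Write342Y` (the two dictionary hypotheses of `B9SectBGpFrameCodedY.gpFrame₂Coded`) PROVED for it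

T. Bałaban, *Propagators for lattice gauge theories in a background field*, Commun. Math. Phys. **99** (1985) 389–434
[`Balaban1985BackgroundPropagators`, "B9"]; [4] = T. Bałaban, *Propagators and renormalization transformations for lattice gauge
theories. II*, Commun. Math. Phys. **96** (1984) 223–250 [`Balaban1984PropagatorsII`].

statement-level skeleton of published theorems with citation tags; proofs where landed; nothing here is a claim about the
Yang–Mills mass gap

THE PRINTED LOCI.  (3.39) p. 397 (the norms of `𝔤`-valued functions λ); Thm 3.1 (3.42) p. 397 (the four sup entries `|G′λ|, |∇_UG′λ|, |G′∇*_Uλ|, |Δ_UG′λ|`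
«for x ∈ Δ(y), supp λ ⊂ Δ(y′)»); (3.3) p. 390 (∇_U), (3.8) p. 392 (∇*_U), (3.23) p. 394 (Δ_U); p. 403 («of course with different constants»); [4] (2.51) p. 232
(block majorants `|(Tλ)(x)| ≦ K(y, y′)|λ|`).

WHY THIS FILE (pub-ymgap N06 row 13, seat dag-n06-c gen 7).  `B9SectBGpFrameCodedY.gpFrame₂Coded` inhabits the root Sect.-B frame over the coded carrier
modulo `hread : Read342Y …` and `hwrite : Write342Y …` — the (3.42) READING (block of the family ⇒ block majorants of the conj-`b` letters `Gop`,
`∇♯_k·Gop`, `Gop·∇♯_k`, `Lap·Gop`) and WRITING (majorants ⇒ block) dictionaries of the coded family `KC`.  Two observations fix `KC`: (i) the frame's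
difference letters `∇♯_k`, `k ∈ κ ⊕ κ`, are BOTH the forward (3.3) and the backward (3.8) covariant differences, on BOTH sides of G′, whereas NODE 00's
`kernelFamilyS` reads only print's two entries `∇_UG′` (forward-left) and `G′∇*_U` (backward-right) — so the family must be AUGMENTED (entries 1 and 2 =
`max` over both differences); (ii) at a product `U′U` the frame's letters are those of the BASE `U` (∇_U, Δ_U applied to G′(U′U)) — a reading over the
CODED carrier can take them at the remembered base.  Hence `kernelFamilySC` (§1), and for it both dictionaries are finite-dimensional linear algebra:
* §0 the ABSTRACT DICTIONARY for any `ℝ`-linear letter `T` of `𝔸`-valued site functions and any real basis `b` with coordinate constant `M₂`: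
  ★ `hasMajorant_conj_of_liftY_bound` (bounds on product-form inputs `f ⊗ E`, `‖E‖ ≦ 1` ⇒ `HasMajorant … (conj b T) ((M₂Σ‖b_j‖)·K)`: `coord⁻¹μ = Σ_j μ_j ⊗ b_j`,
  rescaling `b_j` into the ball) and ★ `liftY_bound_of_hasMajorant_conj` (the converse: the coordinates of `f ⊗ E` are `f·repr E`, block-supported);
* §1 `baseY`, `eLatSC`, ★ `kernelFamilySC i B cfg O par` (+ `_e_inl`, `_e_inr`), `norm_le_supBlkS(')`;
* §2 at the record: `KSC G x par C37 C38` := the augmented coded readings of NODE 00's genuine `G′ = GpY par` over the coding of `bg9Y`; `etaS_eq_eta`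
  (print's units at members), `suppIn_inl_of_blkC`, `supNorm_inl_le`, `exists_ball_bound` (letters are bounded on the ball — 𝔸 finite-dimensional),
  `exists_ball_bound_eLatSC`, `eLatSC_le_of_eBlock`, ★ `liftY_bound_zero ∕ _one ∕ _two ∕ _three` (the four pointwise bounds on `f ⊗ E` from the (3.42) block);
* §3 ★★ `read342Y_KSC : Read342Y G x par b ιB C37 C38 (KSC …) c35 (M₂·Σ_j‖b_j‖) MInv aInv 0 True`;
* §4 `len_label`, `dist_label`, `off_of_suppIn_inl`, `abs_le_supNorm_inl`, `supNorm_nonneg`, `norm_letters` (the values of the four letter products),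
  ★★ `write342Y_KSC : Write342Y G x par b ιB C37 C38 (KSC …) (fun B _ => (M₂·Σ_j‖b_j‖)·B + 1) (fun δ => δ) aW 0 True` (for any coded class whose
  members have a `G`-valued base).
With these, `gpFrame₂Coded` at `KC := KSC` has ONE named hypothesis left: `hC37` (the class (3.37) in the letters form, incl. (3.58)) — and the structural
`hι hG1 hpar hunit`.  What the AUGMENTATION costs is paid in the TRANSFER `SectBStepPrinted … KSC → SectBStepPrinted … (pullK K)` (next file: the cross
entries from print's two by the unitary neighbour shift `∇*_μ g(x) = −R(U_μ(x−μ))⁻¹(∇_μ g)(x−μ)`, and ∇_U ↦ ∇_{U′U} at products by (3.70); both with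
`(B, δ, a₁)`-dependent constants, which `SectBStepPrinted`'s existential output constants allow).

HONEST SCOPE.  Finite-dimensional linear algebra and bookkeeping over NODE 00's DEFINED readings; the block labels `ιB` are a SECTION of `β` (`hι`),
which exists exactly at the CORNER-FREE members (`B9BetaRangeKLevelV1.surjective_beta_iff`; ref-E READ-1∕10) — at a cornered member every statement displaying `hι`
is vacuous (a quasi-section at bounded distance would serve the same estimates with larger constants; not done here; v1.1 doc-only note); no estimate of [B9] is proved or asserted; the
augmented family is NOT the record's family (the transfer is owed); COUNT-NEUTRAL; N06 NOT discharged; one finite lattice programme — nothing continuum ∕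
OS ∕ mass-gap ∕ Clay.  Cell `pub-ymgap` (HUMAN RULING D-0062), Track A node N06 [B9], N06-ASSIGNMENT row 13, 2026-08-27.

RELATED IN THE TREE, NOT DUPLICATED: `B9SectBGpFrameCodedY` (`Read342Y`, `Write342Y`, `codingYx`, `gpFrame₂Coded`), `B9SectBGpLettersY` (letters), `Node00.OpsYOfLetters`
(`kernelFamilyS`, `liftY`, `supBlkS(')`, `iSup_ball_le`), `B9Eq352DivFormLetters` (`conj`, `coordEquiv`), `B9Thm314WholeExpansionReads` (`le_iSup_ball`),
`B9Ineq349SiteComposite` (`supBlkS_le`, `supBlkS'_le`, `cdSL`, `cdsSL`), n06-d's `B9CoReadingCoordsS` (the κ-fold analogue for the walk-expansion rows — a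
different model, not used here) — USED BY NAME where cited; no existing module modified.
-/

noncomputable section

namespace Literature.MathematicalPhysics.QuantumFieldTheory.Balaban1983to89.B9SectBGpReadingsY

open Literature.MathematicalPhysics.QuantumFieldTheory.Balaban1983to89.B6RandomWalk (HasMajorant BlockSupp)
open Literature.MathematicalPhysics.QuantumFieldTheory.Balaban1983to89.B9Eq352DivFormLetters (conj conj_apply coordEquiv coordEquiv_apply coordEquiv_symm_apply)
open Literature.MathematicalPhysics.QuantumFieldTheory.Balaban1983to89.Node00 (liftY liftY_apply)

variable {𝔸 : Type} [NormedRing 𝔸] [NormedAlgebra ℂ 𝔸]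

/-! ## §0 The abstract dictionary: sup-over-directions readings of `T` on product-form inputs ↔ block majorants of `conj b T` -/

section Abstract

variable {ι : Type} [Fintype ι] (b : Module.Basis ι ℝ 𝔸) {S : Type} {g : B6.Geometry} (blk : S → g.Site)

/-- the inverse coordinate map is a sum of product-form lifts along the basis: `coord⁻¹μ = Σ_j μ(·,j) ⊗ b_j`.
[cite: Balaban1984PropagatorsII, (2.51) p.232; Balaban1985BackgroundPropagators, (3.39) p.397, bookkeeping] -/
theorem coordEquiv_symm_eq_sum_liftY (μ : S × ι → ℝ) : (coordEquiv b).symm μ = ∑ j, liftY (fun z => μ (z, j)) (b j) := by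
  funext z
  rw [coordEquiv_symm_apply, Finset.sum_apply]
  refine Finset.sum_congr rfl fun j _ => ?_
  rw [liftY_apply, Complex.coe_smul]

/-- a product-form lift rescales into the unit ball: `f ⊗ v = (‖v‖·f) ⊗ (‖v‖⁻¹v)` for `v ≠ 0`. [cite: Balaban1985BackgroundPropagators, (3.39) p.397, bookkeeping] -/
theorem liftY_eq_liftY_unit (f : S → ℝ) {v : 𝔸} (hv : v ≠ 0) :
    liftY f v = liftY (fun z => ‖v‖ * f z) ((‖v‖⁻¹ : ℝ) • v) := by
  funext z
  have hn : ‖v‖ ≠ 0 := norm_ne_zero_iff.2 hv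
  rw [liftY_apply, liftY_apply, ← Complex.coe_smul ‖v‖⁻¹ v, smul_smul, ← Complex.ofReal_mul,
    show ‖v‖ * f z * ‖v‖⁻¹ = f z by field_simp]

/-- the coordinates of a product-form lift: `coord(f ⊗ E)(z, j) = f(z)·(repr E)_j`. [cite: Balaban1984PropagatorsII, (2.51) p.232, bookkeeping] -/
theorem coordEquiv_liftY (f : S → ℝ) (E : 𝔸) (p : S × ι) : coordEquiv b (liftY f E) p = f p.1 * b.repr E p.2 := by
  rw [coordEquiv_apply, liftY_apply, Complex.coe_smul, map_smul, Finsupp.smul_apply, smul_eq_mul]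

/-- ★ **READING ⇒ MAJORANT**: if the letter `T` satisfies, on every product-form input `f ⊗ E` with `‖E‖ ≦ 1`, `f` supported in the block `y′` and `|f| ≦ B`,
the pointwise bound `‖(T(f ⊗ E))(z)‖ ≦ K(y(z), y′)·B`, then its real-coordinate conjugate has the block majorant `(M₂·Σ_j‖b_j‖)·K` (`M₂` the
coordinate constant of the basis).  [cite: Balaban1985BackgroundPropagators, (3.39) p.397 (𝔤-valued λ), (3.42) p.397; Balaban1984PropagatorsII, (2.51) p.232] -/
theorem hasMajorant_conj_of_liftY_bound (T : Module.End ℝ (S → 𝔸)) (K : g.Site → g.Site → ℝ) (M₂ : ℝ) (hM₂ : 0 ≤ M₂)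
    (hrepr : ∀ (v : 𝔸) (j : ι), |b.repr v j| ≤ M₂ * ‖v‖)
    (hT : ∀ (f : S → ℝ) (E : 𝔸) (y' : g.Site) (B : ℝ), ‖E‖ ≤ 1 → 0 ≤ B → (∀ z, blk z ≠ y' → f z = 0) → (∀ z, |f z| ≤ B) →
      ∀ z, ‖T (liftY f E) z‖ ≤ K (blk z) y' * B) :
    HasMajorant (g := g) (fun p : S × ι => blk p.1) (conj b T) (fun a a' => (M₂ * ∑ j, ‖b j‖) * K a a') := by
  intro y' μ B hμ p
  have hj : ∀ j, ‖T (liftY (fun z => μ (z, j)) (b j)) p.1‖ ≤ K (blk p.1) y' * (‖b j‖ * B) := by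
    intro j
    rw [liftY_eq_liftY_unit _ (b.ne_zero j)]
    refine hT _ _ y' _ ?_ (mul_nonneg (norm_nonneg _) hμ.nonneg) (fun z hz => ?_) (fun z => ?_) p.1
    · rw [norm_smul, Real.norm_eq_abs, abs_of_nonneg (inv_nonneg.2 (norm_nonneg _)), inv_mul_cancel₀ (norm_ne_zero_iff.2 (b.ne_zero j))]
    · rw [hμ.off (z, j) hz, mul_zero]
    · rw [abs_mul, abs_of_nonneg (norm_nonneg _)]
      by_cases hz : blk z = y'
      · exact mul_le_mul_of_nonneg_left (hμ.bound (z, j) hz) (norm_nonneg _)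
      · rw [hμ.off (z, j) hz, abs_zero, mul_zero]; exact mul_nonneg (norm_nonneg _) hμ.nonneg
  have hsum : T ((coordEquiv b).symm μ) p.1 = ∑ j, T (liftY (fun z => μ (z, j)) (b j)) p.1 := by
    rw [coordEquiv_symm_eq_sum_liftY, map_sum, Finset.sum_apply]
  calc |conj b T μ p| = |b.repr (T ((coordEquiv b).symm μ) p.1) p.2| := by rw [conj_apply]
    _ ≤ M₂ * ‖T ((coordEquiv b).symm μ) p.1‖ := hrepr _ _
    _ ≤ M₂ * ∑ j, ‖T (liftY (fun z => μ (z, j)) (b j)) p.1‖ := by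
        rw [hsum]; exact mul_le_mul_of_nonneg_left (norm_sum_le _ _) hM₂
    _ ≤ M₂ * ∑ j, K (blk p.1) y' * (‖b j‖ * B) := mul_le_mul_of_nonneg_left (Finset.sum_le_sum fun j _ => hj j) hM₂
    _ = (M₂ * ∑ j, ‖b j‖) * K (blk p.1) y' * B := by
        have : ∑ j, K (blk p.1) y' * (‖b j‖ * B) = (∑ j, ‖b j‖) * (K (blk p.1) y' * B) := by
          rw [Finset.sum_mul]; exact Finset.sum_congr rfl fun j _ => by ring
        rw [this]; ring

/-- ★ **MAJORANT ⇒ READING**: a block majorant `K` of the real-coordinate conjugate of `T` bounds `T` on every product-form input: for `‖E‖ ≦ 1`, `f` supported in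
the block `y′` with `|f| ≦ B`, `‖(T(f ⊗ E))(z)‖ ≦ (M₂·Σ_j‖b_j‖)·K(y(z), y′)·B`.
[cite: Balaban1985BackgroundPropagators, (3.39) p.397, (3.42) p.397; Balaban1984PropagatorsII, (2.51) p.232] -/
theorem liftY_bound_of_hasMajorant_conj (T : Module.End ℝ (S → 𝔸)) (K : g.Site → g.Site → ℝ) (M₂ : ℝ) (hM₂ : 0 ≤ M₂)
    (hrepr : ∀ (v : 𝔸) (j : ι), |b.repr v j| ≤ M₂ * ‖v‖)
    (h : HasMajorant (g := g) (fun p : S × ι => blk p.1) (conj b T) K)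
    (f : S → ℝ) (E : 𝔸) (y' : g.Site) (B : ℝ) (hE : ‖E‖ ≤ 1) (hB : 0 ≤ B) (hoff : ∀ z, blk z ≠ y' → f z = 0) (hbd : ∀ z, |f z| ≤ B)
    (z : S) : ‖T (liftY f E) z‖ ≤ (M₂ * ∑ j, ‖b j‖) * K (blk z) y' * B := by
  set μ : S × ι → ℝ := coordEquiv b (liftY f E) with hμdef
  have hμ : BlockSupp (fun p : S × ι => blk p.1) μ y' (M₂ * B) := by
    refine ⟨mul_nonneg hM₂ hB, fun p hp => ?_, fun p hp => ?_⟩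
    · rw [hμdef, coordEquiv_liftY, abs_mul]
      calc |f p.1| * |b.repr E p.2| ≤ B * (M₂ * ‖E‖) := mul_le_mul (hbd _) (hrepr _ _) (abs_nonneg _) hB
        _ ≤ B * (M₂ * 1) := mul_le_mul_of_nonneg_left (mul_le_mul_of_nonneg_left hE hM₂) hB
        _ = M₂ * B := by ring
    · rw [hμdef, coordEquiv_liftY, hoff p.1 hp, zero_mul]
  have hcoord : ∀ j, |b.repr (T (liftY f E) z) j| ≤ K (blk z) y' * (M₂ * B) := by
    intro j
    have := h y' μ (M₂ * B) hμ (z, j)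
    rwa [conj_apply, hμdef, LinearEquiv.symm_apply_apply] at this
  have hexp : T (liftY f E) z = ∑ j, (b.repr (T (liftY f E) z) j) • b j := (b.sum_repr _).symm
  calc ‖T (liftY f E) z‖ = ‖∑ j, (b.repr (T (liftY f E) z) j) • b j‖ := by rw [← hexp]
    _ ≤ ∑ j, ‖(b.repr (T (liftY f E) z) j) • b j‖ := norm_sum_le _ _
    _ = ∑ j, |b.repr (T (liftY f E) z) j| * ‖b j‖ := Finset.sum_congr rfl fun j _ => by rw [norm_smul, Real.norm_eq_abs]
    _ ≤ ∑ j, K (blk z) y' * (M₂ * B) * ‖b j‖ := Finset.sum_le_sum fun j _ => mul_le_mul_of_nonneg_right (hcoord j) (norm_nonneg _)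
    _ = (M₂ * ∑ j, ‖b j‖) * K (blk z) y' * B := by rw [← Finset.mul_sum]; ring

end Abstract

/-! ## §1 The AUGMENTED reading family of a site-sector letter over the coded configurations -/

section Family

open Literature.MathematicalPhysics.QuantumFieldTheory.Balaban1983to89.B6KLevelCensusIndexV1 (KIdx kGeo)
open Literature.MathematicalPhysics.QuantumFieldTheory.Balaban1983to89.B6Ineq2142KLevelV1 (β)
open Literature.MathematicalPhysics.QuantumFieldTheory.Balaban1983to89.B6Prop22KLevelCensusEta (epow)
open Literature.MathematicalPhysics.QuantumFieldTheory.Balaban1983to89.B9Eq39Adjoint (fluct)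
open Literature.MathematicalPhysics.QuantumFieldTheory.Balaban1983to89.B9SectBCodedCarrier (CCfg)
open Literature.MathematicalPhysics.QuantumFieldTheory.Balaban1983to89.B9Eq360DeltaPrimeAY (AfldY)
open Literature.MathematicalPhysics.QuantumFieldTheory.Balaban1983to89.B9SectBGpLettersY (decY)
open Literature.MathematicalPhysics.QuantumFieldTheory.Balaban1983to89.Node00 (SiteY BlkY IBondY CfgY BallY SiteOpY SiteParY cdS cdsS lapS etaS supBlkS
  supBlkS' kernelFamilyS)

variable {d ℓ : ℕ} {hd : 1 ≤ d + 1} {hL : Odd (ℓ + 1) ∧ 1 < ℓ + 1} {b₀ b₁ : ℝ} [CompleteSpace 𝔸] (i : KIdx d ℓ hd hL b₀ b₁)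

/-- the BASE configuration of a coded configuration: the letters ∇_U, ∇*_U, Δ_U of a reading at a product `U′U` are taken AT THE BASE `U` (the frames'
«letters at the real U»). [cite: Balaban1985BackgroundPropagators, p.403 l.1–9 (the letters of the step at U), bookkeeping] -/
def baseY : CCfg (CfgY 𝔸 i) (AfldY 𝔸 i) → CfgY 𝔸 i
  | .base U => U
  | .mult a => fluct (kGeo i).eta a
  | .prod U _ => U

/-- the AUGMENTED four sup entries of a site-sector letter `O` at (base `U₀`, configuration `V`, input `Λ`, block `s`): entry 0 and 3 as in
`Node00.eLatS` (with the Laplacian at `U₀`); entries 1 and 2 take BOTH covariant differences ∇_{U₀}, ∇*_{U₀} (on the left, resp. on the right) — the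
sup readings the Sect.-B frames' letters `∇♯_k·G′`, `G′·∇♯_k` (k over forward AND backward bonds) require. [cite: Balaban1985BackgroundPropagators, (3.42) p.397, (3.3) p.390, (3.8) p.392] -/
def eLatSC (O : SiteOpY 𝔸 i) (U₀ V : CfgY 𝔸 i) (Λ : SiteY i → 𝔸) (s : BlkY i) : Fin 4 → ℝ :=
  ![supBlkS i s (O V Λ),
    max (supBlkS' i s (fun μ => cdS i U₀ μ (O V Λ))) (supBlkS' i s (fun μ => cdsS i U₀ μ (O V Λ))),
    max (supBlkS' i s (fun μ => O V (cdS i U₀ μ Λ))) (supBlkS' i s (fun μ => O V (cdsS i U₀ μ Λ))),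
    supBlkS i s (lapS i U₀ (O V Λ))]

open Classical in
/-- ★ **THE AUGMENTED CODED READING FAMILY of a site-sector letter** over a backgrounds record whose configurations decode to coded configurations
(`cfg`): the (3.42) entries are the augmented sups `eLatSC` at (base, decoding), scaled by `η^{(2,1,1,0)}` and sup'd over the directions of the unit
ball, ON `.inl`, `0` OFF; every other member is `Node00.kernelFamilyS`'s at the decoded configuration.
[cite: Balaban1985BackgroundPropagators, Thm 3.1 (3.42)–(3.47) pp.397–398] -/
def kernelFamilySC (B : B9.Backgrounds) (cfg : B.Cfg → CCfg (CfgY 𝔸 i) (AfldY 𝔸 i)) (O : SiteOpY 𝔸 i) (par : SiteParY 𝔸 i) :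
    B9.KernelFamily (B9GeoNormsKLevelV1.geo9K i) B :=
  { kernelFamilyS i B (fun U' => decY i (cfg U')) O par with
    e := fun n U' lam bb => match lam with
      | .inl f => etaS i ^ (epow n) * ⨆ E : BallY 𝔸, eLatSC i O (baseY i (cfg U')) (decY i (cfg U')) (liftY f (E : 𝔸)) (β i.hN i.D i.hk bb) n
      | .inr _ => 0 }

/-- the augmented entries ON `.inl`. [cite: Balaban1985BackgroundPropagators, (3.42) p.397, bookkeeping] -/
theorem kernelFamilySC_e_inl (B : B9.Backgrounds) (cfg : B.Cfg → CCfg (CfgY 𝔸 i) (AfldY 𝔸 i)) (O : SiteOpY 𝔸 i) (par : SiteParY 𝔸 i)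
    (n : Fin 4) (U' : B.Cfg) (f : SiteY i → ℝ) (bb : IBondY i) :
    (kernelFamilySC i B cfg O par).e n U' (.inl f) bb
      = etaS i ^ (epow n) * ⨆ E : BallY 𝔸, eLatSC i O (baseY i (cfg U')) (decY i (cfg U')) (liftY f (E : 𝔸)) (β i.hN i.D i.hk bb) n := rfl

/-- the augmented entries OFF (bond-sector arguments): `0`. [cite: Balaban1985BackgroundPropagators, (3.42) p.397, bookkeeping] -/
theorem kernelFamilySC_e_inr (B : B9.Backgrounds) (cfg : B.Cfg → CCfg (CfgY 𝔸 i) (AfldY 𝔸 i)) (O : SiteOpY 𝔸 i) (par : SiteParY 𝔸 i)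
    (n : Fin 4) (U' : B.Cfg) (J : Node00.FBondY i → ℝ) (bb : IBondY i) :
    (kernelFamilySC i B cfg O par).e n U' (.inr J) bb = 0 := rfl

omit [NormedAlgebra ℂ 𝔸] [CompleteSpace 𝔸] in
/-- a norm on the block is below the block sup. [cite: Balaban1985BackgroundPropagators, (3.42) p.397 («for x ∈ Δ(y)»), bookkeeping] -/
theorem norm_le_supBlkS (s : BlkY i) (Ψ : SiteY i → 𝔸) {z : SiteY i} (hz : B6Geom246MultiLevelBox.blkOf i.D.toDomains z = s) :
    ‖Ψ z‖ ≤ supBlkS i s Ψ := by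
  classical
  unfold supBlkS
  have h := le_ciSup (f := fun z : SiteY i => if B6Geom246MultiLevelBox.blkOf i.D.toDomains z = s then ‖Ψ z‖ else 0)
    (Set.finite_range _).bddAbove z
  rwa [if_pos hz] at h

omit [NormedAlgebra ℂ 𝔸] [CompleteSpace 𝔸] in
/-- a directional norm on the block is below the directional block sup. [cite: Balaban1985BackgroundPropagators, (3.42) p.397, bookkeeping] -/
theorem norm_le_supBlkS' (s : BlkY i) (Ψ : Fin (d + 1) → SiteY i → 𝔸) {z : SiteY i} (μ : Fin (d + 1))
    (hz : B6Geom246MultiLevelBox.blkOf i.D.toDomains z = s) : ‖Ψ μ z‖ ≤ supBlkS' i s Ψ := by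
  classical
  unfold supBlkS'
  have h := le_ciSup (f := fun p : SiteY i × Fin (d + 1) => if B6Geom246MultiLevelBox.blkOf i.D.toDomains p.1 = s then ‖Ψ p.2 p.1‖ else 0)
    (Set.finite_range _).bddAbove (z, μ)
  rwa [if_pos (show B6Geom246MultiLevelBox.blkOf i.D.toDomains (z, μ).1 = s from hz)] at h

end Family

/-! ## §2 The record family and the tools at the record -/

section Record

open Literature.MathematicalPhysics.QuantumFieldTheory.Balaban1983to89.B6KLevelCensusIndexV1 (KIdx kGeo)
open Literature.MathematicalPhysics.QuantumFieldTheory.Balaban1983to89.B6Ineq2142KLevelV1 (β)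
open Literature.MathematicalPhysics.QuantumFieldTheory.Balaban1983to89.B6Prop22KLevelCensusEta (epow)
open Literature.MathematicalPhysics.QuantumFieldTheory.Balaban1983to89.B9Thm34Ext (toB6)
open Literature.MathematicalPhysics.QuantumFieldTheory.Balaban1983to89.B9FromB6 (EBlock)
open Literature.MathematicalPhysics.QuantumFieldTheory.Balaban1983to89.B9Eq352GradLetters (diffLetter)
open Literature.MathematicalPhysics.QuantumFieldTheory.Balaban1983to89.B9SectBCodedCarrier (CCfg)
open Literature.MathematicalPhysics.QuantumFieldTheory.Balaban1983to89.B9Eq360DeltaPrimeAY (AfldY blkY blkY_apply)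
open Literature.MathematicalPhysics.QuantumFieldTheory.Balaban1983to89.B9PinMembersKLevelV1 (MemberY geo9Y bg9Y)
open Literature.MathematicalPhysics.QuantumFieldTheory.Balaban1983to89.B9SectBGpLettersY (decY GVal coordC blkC ΔpC GopC LapC)
open Literature.MathematicalPhysics.QuantumFieldTheory.Balaban1983to89.B9SectBGpFrameCodedY (codingYx Read342Y Write342Y)
open Literature.MathematicalPhysics.QuantumFieldTheory.Balaban1983to89.B9Thm314WholeExpansionReads (le_iSup_ball)
open Literature.MathematicalPhysics.QuantumFieldTheory.Balaban1983to89.Node00 (SiteY BlkY IBondY CfgY BallY SiteOpY SiteParY UboxY shiftY cdS cdsS lapS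
  etaS supBlkS supBlkS' GpY)

variable {d ℓ : ℕ} {hd : 1 ≤ d + 1} {hL : Odd (ℓ + 1) ∧ 1 < ℓ + 1} {b₀ b₁ : ℝ} {Mstar : ℕ} [CompleteSpace 𝔸] [FiniteDimensional ℝ 𝔸]
  (G : Subgroup 𝔸ˣ) (x : MemberY d ℓ hd hL b₀ b₁ Mstar) (par : SiteParY 𝔸 x.toKIdx) {ι : Type} [Fintype ι] (b : Module.Basis ι ℝ 𝔸)
  (ιB : BlkY x.toKIdx → IBondY x.toKIdx) (C37 C38 : ℝ → CfgY 𝔸 x.toKIdx → AfldY 𝔸 x.toKIdx → Prop)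

/-- ★ **THE FAMILY OF RECORD FOR THE G′ ROOT FRAME**: the augmented coded readings of NODE 00's genuine letter `G′(U) = GpY par` over the coding of `bg9Y`.
[cite: Balaban1985BackgroundPropagators, (3.25) p.394, Thm 3.1 (3.42) p.397] -/
def KSC : B9.KernelFamily (geo9Y x) (codingYx G x C37 C38).bg :=
  kernelFamilySC x.toKIdx (codingYx G x C37 C38).bg (fun c => c) (GpY x.toKIdx par) par

omit [CompleteSpace 𝔸] [FiniteDimensional ℝ 𝔸] in
/-- the members of record live in print's units: the reading's `η` IS the geometry's `η`. [cite: Balaban1984PropagatorsII, (2.1) p.224 («η = L^{−k}»)] -/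
theorem etaS_eq_eta : etaS x.toKIdx = (kGeo x.toKIdx).eta := by
  show ((((B6Prop22KLevelTorusCensusEta.nKT (Node00.toKT x.toKIdx) : ℕ) : ℝ)))⁻¹ = |x.cf|⁻¹
  unfold B6Prop22KLevelTorusCensusEta.nKT
  rw [x.hcfk, abs_of_nonneg (by positivity)]
  push_cast
  rfl

omit [FiniteDimensional ℝ 𝔸] in
/-- a support inside the labelled block `y′` of the frame is a support inside the genuine block `β y′` (the labelling is a section of `β`).
[cite: Balaban1985BackgroundPropagators, (3.42) p.397 («supp λ ⊂ Δ(y′)»), bookkeeping] -/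
theorem suppIn_inl_of_blkC (hι : ∀ s : BlkY x.toKIdx, β x.toKIdx.hN x.toKIdx.D x.toKIdx.hk (ιB s) = s) {f : SiteY x.toKIdx → ℝ} {y' : IBondY x.toKIdx}
    (hoff : ∀ z, blkC x.toKIdx ιB z ≠ y' → f z = 0) : (geo9Y x).suppIn (.inl f) y' := by
  intro w hw
  by_contra hne
  refine hw (hoff w fun h => hne ?_)
  have := congrArg (β x.toKIdx.hN x.toKIdx.D x.toKIdx.hk) h
  rw [blkC, hι] at this
  exact this

omit [CompleteSpace 𝔸] [FiniteDimensional ℝ 𝔸] in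
/-- the reading's `|λ|` of a scalar site function below a pointwise bound. [cite: Balaban1985BackgroundPropagators, (3.39) p.397 («|λ|»), bookkeeping] -/
theorem supNorm_inl_le {f : SiteY x.toKIdx → ℝ} {B : ℝ} (hB : 0 ≤ B) (hbd : ∀ z, |f z| ≤ B) : (geo9Y x).supNorm (.inl f) ≤ B :=
  Real.iSup_le hbd hB

/-- **EVERY LETTER IS BOUNDED ON THE UNIT BALL** (𝔸 finite-dimensional): `‖(T(f ⊗ E))(z)‖ ≦ C` uniformly in `‖E‖ ≦ 1` and `z`.
[cite: Balaban1985BackgroundPropagators, (3.39) p.397, bookkeeping] -/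
theorem exists_ball_bound (T : (SiteY x.toKIdx → 𝔸) →ₗ[ℝ] (SiteY x.toKIdx → 𝔸)) (f : SiteY x.toKIdx → ℝ) :
    ∃ C : ℝ, 0 ≤ C ∧ ∀ (E : BallY 𝔸) (z : SiteY x.toKIdx), ‖T (liftY f (E : 𝔸)) z‖ ≤ C := by
  refine ⟨‖LinearMap.toContinuousLinearMap T‖ * ‖f‖, mul_nonneg (ContinuousLinearMap.opNorm_nonneg _) (norm_nonneg _), fun E z => ?_⟩
  have hE : ‖(E : 𝔸)‖ ≤ 1 := mem_closedBall_zero_iff.1 E.2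
  have hlift : ‖liftY f (E : 𝔸)‖ ≤ ‖f‖ := by
    refine (pi_norm_le_iff_of_nonneg (norm_nonneg f)).2 fun w => ?_
    rw [liftY_apply, norm_smul, Complex.norm_real]
    exact (mul_le_of_le_one_right (norm_nonneg _) hE).trans (norm_le_pi_norm f w)
  calc ‖T (liftY f (E : 𝔸)) z‖ ≤ ‖T (liftY f (E : 𝔸))‖ := norm_le_pi_norm _ z
    _ = ‖LinearMap.toContinuousLinearMap T (liftY f (E : 𝔸))‖ := by rw [LinearMap.coe_toContinuousLinearMap']
    _ ≤ ‖LinearMap.toContinuousLinearMap T‖ * ‖liftY f (E : 𝔸)‖ := ContinuousLinearMap.le_opNorm _ _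
    _ ≤ ‖LinearMap.toContinuousLinearMap T‖ * ‖f‖ := mul_le_mul_of_nonneg_left hlift (ContinuousLinearMap.opNorm_nonneg _)

/-- ★ **ENTRY 0 OF THE READING**: the (3.42) block of the augmented family at `base U` bounds `η²‖(G′(U)(f ⊗ E))(z)‖` for `f` supported in the labelled
block `y′`, `|f| ≦ B`, `‖E‖ ≦ 1`, by `(η/η_S)²·B₀·(Lʲη)²e^{−δd(y(z),y′)}·B`. [cite: Balaban1985BackgroundPropagators, (3.42) p.397 (first entry)] -/
theorem liftY_bound_zero (hι : ∀ s : BlkY x.toKIdx, β x.toKIdx.hN x.toKIdx.D x.toKIdx.hk (ιB s) = s) {U : CfgY 𝔸 x.toKIdx} {B₀ δ : ℝ}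
    (hB₀ : 0 ≤ B₀) (hE : EBlock (KSC G x par C37 C38) B₀ δ (.base U))
    (f : SiteY x.toKIdx → ℝ) (E : 𝔸) (y' : IBondY x.toKIdx) (B : ℝ) (hE1 : ‖E‖ ≤ 1) (hB : 0 ≤ B)
    (hoff : ∀ z, blkC x.toKIdx ιB z ≠ y' → f z = 0) (hbd : ∀ z, |f z| ≤ B) (z : SiteY x.toKIdx) :
    ‖(((kGeo x.toKIdx).eta ^ 2) • (GpY x.toKIdx par U).restrictScalars ℝ) (liftY f E) z‖
      ≤ (B₀ * (geo9Y x).len (blkC x.toKIdx ιB z) ^ 2 * Real.exp (-(δ * (geo9Y x).dist (blkC x.toKIdx ιB z) y'))) * B := by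
  set η := (kGeo x.toKIdx).eta with hηdef
  have hη0 : 0 < η := B9GeoLemma21KLevelV1.geo9K_eta_pos x.toKIdx
  have hblk : β x.toKIdx.hN x.toKIdx.D x.toKIdx.hk (blkC x.toKIdx ιB z) = blkY x.toKIdx z := by rw [blkC, hι]
  -- the reading at the labelled block of `z`
  have hread := hE 0 (.inl f) (blkC x.toKIdx ιB z) y' (suppIn_inl_of_blkC x ιB hι hoff)
  rw [KSC, kernelFamilySC_e_inl, hblk] at hread
  have hpref : B9.pref4 ((geo9Y x).len (blkC x.toKIdx ιB z)) 0 = (geo9Y x).len (blkC x.toKIdx ιB z) ^ 2 := rfl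
  have hep : epow 0 = 2 := rfl
  rw [hpref, hep, etaS_eq_eta] at hread
  -- the term: η²·‖(G′(U)(f ⊗ E))(z)‖
  have hval : (((kGeo x.toKIdx).eta ^ 2) • (GpY x.toKIdx par U).restrictScalars ℝ) (liftY f E) z = (η ^ 2 : ℝ) • GpY x.toKIdx par U (liftY f E) z := rfl
  rw [hval, norm_smul, Real.norm_eq_abs, abs_of_nonneg (by positivity)]
  -- ‖(G′(U)(f ⊗ E))(z)‖ ≤ the block sup ≤ the sup over the ball
  obtain ⟨C, -, hC⟩ := exists_ball_bound x ((GpY x.toKIdx par U).restrictScalars ℝ) f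
  have h1 : ‖GpY x.toKIdx par U (liftY f E) z‖ ≤ supBlkS x.toKIdx (blkY x.toKIdx z) (GpY x.toKIdx par U (liftY f E)) :=
    norm_le_supBlkS x.toKIdx _ _ rfl
  have h2 : supBlkS x.toKIdx (blkY x.toKIdx z) (GpY x.toKIdx par U (liftY f E))
      ≤ ⨆ E' : BallY 𝔸, eLatSC x.toKIdx (GpY x.toKIdx par) U U (liftY f (E' : 𝔸)) (blkY x.toKIdx z) 0 := by
    have := le_iSup_ball (A := fun E' : BallY 𝔸 => eLatSC x.toKIdx (GpY x.toKIdx par) U U (liftY f (E' : 𝔸)) (blkY x.toKIdx z) 0)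
      ⟨C, fun E' => B9Ineq349SiteComposite.supBlkS_le x.toKIdx _ _ (le_trans (norm_nonneg _) (hC E' z)) fun w _ => hC E' w⟩
      ⟨E, mem_closedBall_zero_iff.2 hE1⟩
    exact this
  have hsup : (geo9Y x).supNorm (.inl f) ≤ B := supNorm_inl_le x hB hbd
  have h3 : η ^ 2 * (⨆ E' : BallY 𝔸, eLatSC x.toKIdx (GpY x.toKIdx par) U U (liftY f (E' : 𝔸)) (blkY x.toKIdx z) 0)
      ≤ B₀ * (geo9Y x).len (blkC x.toKIdx ιB z) ^ 2 * Real.exp (-(δ * (geo9Y x).dist (blkC x.toKIdx ιB z) y')) * B :=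
    hread.trans (mul_le_mul_of_nonneg_left hsup (by positivity))
  calc η ^ 2 * ‖GpY x.toKIdx par U (liftY f E) z‖
      ≤ η ^ 2 * ⨆ E' : BallY 𝔸, eLatSC x.toKIdx (GpY x.toKIdx par) U U (liftY f (E' : 𝔸)) (blkY x.toKIdx z) 0 :=
        mul_le_mul_of_nonneg_left (h1.trans h2) (by positivity)
    _ ≤ _ := h3


omit [CompleteSpace 𝔸] [FiniteDimensional ℝ 𝔸] in
/-- a real multiple of an `𝔸`-valued function is its complex multiple. [folklore] [cite: Balaban1985BackgroundPropagators, (3.39) p.397, bookkeeping] -/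
theorem real_smul_fun {X : Type} (r : ℝ) (g : X → 𝔸) : (r • g) = ((r : ℂ)) • g := by
  funext w; exact (Complex.coe_smul r (g w)).symm

/-- the uniform bound over the ball of the augmented difference entries (finite dimension). [cite: Balaban1985BackgroundPropagators, (3.42) p.397, bookkeeping] -/
theorem exists_ball_bound_eLatSC (O : SiteOpY 𝔸 x.toKIdx) (U₀ V : CfgY 𝔸 x.toKIdx) (f : SiteY x.toKIdx → ℝ) (s : BlkY x.toKIdx) (n : Fin 4) :
    ∃ C : ℝ, ∀ E : BallY 𝔸, eLatSC x.toKIdx O U₀ V (liftY f (E : 𝔸)) s n ≤ C := by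
  obtain ⟨C₀, hC₀, h₀⟩ := exists_ball_bound x ((O V).restrictScalars ℝ) f
  have hL : ∀ μ, ∃ C, 0 ≤ C ∧ ∀ (E : BallY 𝔸) z, ‖cdS x.toKIdx U₀ μ (O V (liftY f (E : 𝔸))) z‖ ≤ C := fun μ =>
    exists_ball_bound x ((B9Ineq349SiteComposite.cdSL x.toKIdx U₀ μ ∘ₗ O V).restrictScalars ℝ) f
  have hLs : ∀ μ, ∃ C, 0 ≤ C ∧ ∀ (E : BallY 𝔸) z, ‖cdsS x.toKIdx U₀ μ (O V (liftY f (E : 𝔸))) z‖ ≤ C := fun μ =>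
    exists_ball_bound x ((B9Ineq349SiteComposite.cdsSL x.toKIdx U₀ μ ∘ₗ O V).restrictScalars ℝ) f
  have hR : ∀ μ, ∃ C, 0 ≤ C ∧ ∀ (E : BallY 𝔸) z, ‖O V (cdS x.toKIdx U₀ μ (liftY f (E : 𝔸))) z‖ ≤ C := fun μ =>
    exists_ball_bound x ((O V ∘ₗ B9Ineq349SiteComposite.cdSL x.toKIdx U₀ μ).restrictScalars ℝ) f
  have hRs : ∀ μ, ∃ C, 0 ≤ C ∧ ∀ (E : BallY 𝔸) z, ‖O V (cdsS x.toKIdx U₀ μ (liftY f (E : 𝔸))) z‖ ≤ C := fun μ =>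
    exists_ball_bound x ((O V ∘ₗ B9Ineq349SiteComposite.cdsSL x.toKIdx U₀ μ).restrictScalars ℝ) f
  have hΔ : ∃ C, 0 ≤ C ∧ ∀ (E : BallY 𝔸) z, ‖lapS x.toKIdx U₀ (O V (liftY f (E : 𝔸))) z‖ ≤ C :=
    exists_ball_bound x ((Node00.lapSL x.toKIdx U₀ ∘ₗ O V).restrictScalars ℝ) f
  choose CL hCL0 hCL using hL
  choose CLs hCLs0 hCLs using hLs
  choose CR hCR0 hCR using hR
  choose CRs hCRs0 hCRs using hRs
  obtain ⟨CΔ, hCΔ0, hCΔ⟩ := hΔ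
  have hsumL : ∀ μ, CL μ ≤ ∑ ν, CL ν := fun μ => Finset.single_le_sum (fun ν _ => hCL0 ν) (Finset.mem_univ μ)
  have hsumLs : ∀ μ, CLs μ ≤ ∑ ν, CLs ν := fun μ => Finset.single_le_sum (fun ν _ => hCLs0 ν) (Finset.mem_univ μ)
  have hsumR : ∀ μ, CR μ ≤ ∑ ν, CR ν := fun μ => Finset.single_le_sum (fun ν _ => hCR0 ν) (Finset.mem_univ μ)
  have hsumRs : ∀ μ, CRs μ ≤ ∑ ν, CRs ν := fun μ => Finset.single_le_sum (fun ν _ => hCRs0 ν) (Finset.mem_univ μ)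
  match n with
  | 0 => exact ⟨C₀, fun E => B9Ineq349SiteComposite.supBlkS_le x.toKIdx s _ hC₀ fun w _ => h₀ E w⟩
  | 1 =>
    refine ⟨max (∑ ν, CL ν) (∑ ν, CLs ν), fun E => max_le_max ?_ ?_⟩
    · exact B9Ineq349SiteComposite.supBlkS'_le x.toKIdx s _ (Finset.sum_nonneg fun ν _ => hCL0 ν) fun w μ _ => (hCL μ E w).trans (hsumL μ)
    · exact B9Ineq349SiteComposite.supBlkS'_le x.toKIdx s _ (Finset.sum_nonneg fun ν _ => hCLs0 ν) fun w μ _ => (hCLs μ E w).trans (hsumLs μ)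
  | 2 =>
    refine ⟨max (∑ ν, CR ν) (∑ ν, CRs ν), fun E => max_le_max ?_ ?_⟩
    · exact B9Ineq349SiteComposite.supBlkS'_le x.toKIdx s _ (Finset.sum_nonneg fun ν _ => hCR0 ν) fun w μ _ => (hCR μ E w).trans (hsumR μ)
    · exact B9Ineq349SiteComposite.supBlkS'_le x.toKIdx s _ (Finset.sum_nonneg fun ν _ => hCRs0 ν) fun w μ _ => (hCRs μ E w).trans (hsumRs μ)
  | 3 => exact ⟨CΔ, fun E => B9Ineq349SiteComposite.supBlkS_le x.toKIdx s _ hCΔ0 fun w _ => hCΔ E w⟩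

/-- the reading of the augmented family at `base U`, read at the labelled block of `z`, unfolded and bounded by the (3.42) block hypothesis.
[cite: Balaban1985BackgroundPropagators, (3.42) p.397, bookkeeping] -/
theorem eLatSC_le_of_eBlock (hι : ∀ s : BlkY x.toKIdx, β x.toKIdx.hN x.toKIdx.D x.toKIdx.hk (ιB s) = s) {U : CfgY 𝔸 x.toKIdx} {B₀ δ : ℝ}
    (hB₀ : 0 ≤ B₀) (hE : EBlock (KSC G x par C37 C38) B₀ δ (.base U)) (n : Fin 4)
    (f : SiteY x.toKIdx → ℝ) (E : 𝔸) (y' : IBondY x.toKIdx) (B : ℝ) (hE1 : ‖E‖ ≤ 1) (hB : 0 ≤ B)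
    (hoff : ∀ z, blkC x.toKIdx ιB z ≠ y' → f z = 0) (hbd : ∀ z, |f z| ≤ B) (z : SiteY x.toKIdx) :
    (kGeo x.toKIdx).eta ^ (epow n) * eLatSC x.toKIdx (GpY x.toKIdx par) U U (liftY f E) (blkY x.toKIdx z) n
      ≤ B₀ * B9.pref4 ((geo9Y x).len (blkC x.toKIdx ιB z)) n * Real.exp (-(δ * (geo9Y x).dist (blkC x.toKIdx ιB z) y')) * B := by
  have hη0 : 0 < (kGeo x.toKIdx).eta := B9GeoLemma21KLevelV1.geo9K_eta_pos x.toKIdx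
  have hblk : β x.toKIdx.hN x.toKIdx.D x.toKIdx.hk (blkC x.toKIdx ιB z) = blkY x.toKIdx z := by rw [blkC, hι]
  have hread := hE n (.inl f) (blkC x.toKIdx ιB z) y' (suppIn_inl_of_blkC x ιB hι hoff)
  rw [KSC, kernelFamilySC_e_inl, hblk, etaS_eq_eta] at hread
  obtain ⟨C, hC⟩ := exists_ball_bound_eLatSC x (GpY x.toKIdx par) U U f (blkY x.toKIdx z) n
  have h2 : eLatSC x.toKIdx (GpY x.toKIdx par) U U (liftY f E) (blkY x.toKIdx z) n
      ≤ ⨆ E' : BallY 𝔸, eLatSC x.toKIdx (GpY x.toKIdx par) U U (liftY f (E' : 𝔸)) (blkY x.toKIdx z) n :=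
    le_iSup_ball (A := fun E' : BallY 𝔸 => eLatSC x.toKIdx (GpY x.toKIdx par) U U (liftY f (E' : 𝔸)) (blkY x.toKIdx z) n) ⟨C, hC⟩
      ⟨E, mem_closedBall_zero_iff.2 hE1⟩
  have hpref : 0 ≤ B9.pref4 ((geo9Y x).len (blkC x.toKIdx ιB z)) n := by
    have hl := (B9GeoLemma21KLevelV1.geo9Y_len_pos x (blkC x.toKIdx ιB z)).le
    match n with
    | 0 => exact pow_nonneg hl 2
    | 1 => exact hl
    | 2 => exact hl
    | 3 => exact zero_le_one
  calc (kGeo x.toKIdx).eta ^ (epow n) * eLatSC x.toKIdx (GpY x.toKIdx par) U U (liftY f E) (blkY x.toKIdx z) n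
      ≤ (kGeo x.toKIdx).eta ^ (epow n) * ⨆ E' : BallY 𝔸, eLatSC x.toKIdx (GpY x.toKIdx par) U U (liftY f (E' : 𝔸)) (blkY x.toKIdx z) n :=
        mul_le_mul_of_nonneg_left h2 (by positivity)
    _ ≤ B₀ * B9.pref4 ((geo9Y x).len (blkC x.toKIdx ιB z)) n * Real.exp (-(δ * (geo9Y x).dist (blkC x.toKIdx ιB z) y')) *
          (geo9Y x).supNorm (.inl f) := hread
    _ ≤ _ := mul_le_mul_of_nonneg_left (supNorm_inl_le x hB hbd) (by positivity)

/-- ★ **ENTRY 1 OF THE READING** (left difference letters, forward AND backward): `‖(∇♯_k·η²G′(U))(f ⊗ E)(z)‖ ≦ B₀(Lʲη)e^{−δd}·B`.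
[cite: Balaban1985BackgroundPropagators, (3.42) p.397 (second entry), (3.3) p.390, (3.8) p.392] -/
theorem liftY_bound_one (hι : ∀ s : BlkY x.toKIdx, β x.toKIdx.hN x.toKIdx.D x.toKIdx.hk (ιB s) = s) {U : CfgY 𝔸 x.toKIdx} {B₀ δ : ℝ}
    (hB₀ : 0 ≤ B₀) (hE : EBlock (KSC G x par C37 C38) B₀ δ (.base U)) (k : Fin (d + 1) ⊕ Fin (d + 1))
    (f : SiteY x.toKIdx → ℝ) (E : 𝔸) (y' : IBondY x.toKIdx) (B : ℝ) (hE1 : ‖E‖ ≤ 1) (hB : 0 ≤ B)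
    (hoff : ∀ z, blkC x.toKIdx ιB z ≠ y' → f z = 0) (hbd : ∀ z, |f z| ≤ B) (z : SiteY x.toKIdx) :
    ‖(diffLetter (shiftY x.toKIdx) (UboxY x.toKIdx U) ((((kGeo x.toKIdx).eta : ℂ))⁻¹) k *
        (((kGeo x.toKIdx).eta ^ 2) • (GpY x.toKIdx par U).restrictScalars ℝ)) (liftY f E) z‖
      ≤ (B₀ * (geo9Y x).len (blkC x.toKIdx ιB z) * Real.exp (-(δ * (geo9Y x).dist (blkC x.toKIdx ιB z) y'))) * B := by
  set η := (kGeo x.toKIdx).eta with hηdef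
  have hη0 : 0 < η := B9GeoLemma21KLevelV1.geo9K_eta_pos x.toKIdx
  have key := eLatSC_le_of_eBlock G x par ιB C37 C38 hι hB₀ hE 1 f E y' B hE1 hB hoff hbd z
  have hep : epow 1 = 1 := rfl
  have hpref : B9.pref4 ((geo9Y x).len (blkC x.toKIdx ιB z)) 1 = (geo9Y x).len (blkC x.toKIdx ιB z) := rfl
  rw [hep, pow_one, hpref] at key
  -- the value of the letter product on `f ⊗ E` at `z`
  set Λ := GpY x.toKIdx par U (liftY f E) with hΛ
  have hval : ∀ μ, (diffLetter (shiftY x.toKIdx) (UboxY x.toKIdx U) (((η : ℂ))⁻¹) (Sum.inl μ) *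
        ((η ^ 2) • (GpY x.toKIdx par U).restrictScalars ℝ)) (liftY f E) z = ((η : ℂ))⁻¹ • ((((η ^ 2 : ℝ)) : ℂ) • cdS x.toKIdx U μ Λ z) := by
    intro μ
    rw [Module.End.mul_apply, B9Eq352GradLetters.diffLetter_inl, B9Eq352DivFormLetters.gradLetterF_apply, LinearMap.smul_apply,
      LinearMap.restrictScalars_apply, real_smul_fun, B9Eq39Adjoint.covD_smul]
    rfl
  have hval' : ∀ μ, (diffLetter (shiftY x.toKIdx) (UboxY x.toKIdx U) (((η : ℂ))⁻¹) (Sum.inr μ) *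
        ((η ^ 2) • (GpY x.toKIdx par U).restrictScalars ℝ)) (liftY f E) z = -(((η : ℂ))⁻¹ • ((((η ^ 2 : ℝ)) : ℂ) • cdsS x.toKIdx U μ Λ z)) := by
    intro μ
    rw [Module.End.mul_apply, B9Eq352GradLetters.diffLetter_inr, LinearMap.neg_apply, Pi.neg_apply, B9Eq352DivFormLetters.gradLetterB_apply,
      LinearMap.smul_apply, LinearMap.restrictScalars_apply, real_smul_fun, B9Eq39Adjoint.covDstar_smul]
    rfl
  have hnorm : ∀ v : 𝔸, ‖((η : ℂ))⁻¹ • ((((η ^ 2 : ℝ)) : ℂ) • v)‖ = η * ‖v‖ := fun v => by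
    rw [norm_smul, norm_smul, norm_inv, Complex.norm_real, Complex.norm_real, Real.norm_eq_abs, Real.norm_eq_abs, abs_of_pos hη0,
      abs_of_nonneg (by positivity)]
    field_simp
  rcases k with μ | μ
  · rw [hval μ, hnorm]
    have h1 : ‖cdS x.toKIdx U μ Λ z‖ ≤ eLatSC x.toKIdx (GpY x.toKIdx par) U U (liftY f E) (blkY x.toKIdx z) 1 :=
      (norm_le_supBlkS' x.toKIdx (blkY x.toKIdx z) (fun μ => cdS x.toKIdx U μ Λ) μ rfl).trans (le_max_left _ _)
    exact (mul_le_mul_of_nonneg_left h1 hη0.le).trans key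
  · rw [hval' μ, norm_neg, hnorm]
    have h1 : ‖cdsS x.toKIdx U μ Λ z‖ ≤ eLatSC x.toKIdx (GpY x.toKIdx par) U U (liftY f E) (blkY x.toKIdx z) 1 :=
      (norm_le_supBlkS' x.toKIdx (blkY x.toKIdx z) (fun μ => cdsS x.toKIdx U μ Λ) μ rfl).trans (le_max_right _ _)
    exact (mul_le_mul_of_nonneg_left h1 hη0.le).trans key


/-- ★ **ENTRY 2 OF THE READING** (right difference letters, forward AND backward): `‖(η²G′(U)·∇♯_k)(f ⊗ E)(z)‖ ≦ B₀(Lʲη)e^{−δd}·B`.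
[cite: Balaban1985BackgroundPropagators, (3.42) p.397 (third entry), (3.3) p.390, (3.8) p.392] -/
theorem liftY_bound_two (hι : ∀ s : BlkY x.toKIdx, β x.toKIdx.hN x.toKIdx.D x.toKIdx.hk (ιB s) = s) {U : CfgY 𝔸 x.toKIdx} {B₀ δ : ℝ}
    (hB₀ : 0 ≤ B₀) (hE : EBlock (KSC G x par C37 C38) B₀ δ (.base U)) (k : Fin (d + 1) ⊕ Fin (d + 1))
    (f : SiteY x.toKIdx → ℝ) (E : 𝔸) (y' : IBondY x.toKIdx) (B : ℝ) (hE1 : ‖E‖ ≤ 1) (hB : 0 ≤ B)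
    (hoff : ∀ z, blkC x.toKIdx ιB z ≠ y' → f z = 0) (hbd : ∀ z, |f z| ≤ B) (z : SiteY x.toKIdx) :
    ‖((((kGeo x.toKIdx).eta ^ 2) • (GpY x.toKIdx par U).restrictScalars ℝ) *
        diffLetter (shiftY x.toKIdx) (UboxY x.toKIdx U) ((((kGeo x.toKIdx).eta : ℂ))⁻¹) k) (liftY f E) z‖
      ≤ (B₀ * (geo9Y x).len (blkC x.toKIdx ιB z) * Real.exp (-(δ * (geo9Y x).dist (blkC x.toKIdx ιB z) y'))) * B := by
  set η := (kGeo x.toKIdx).eta with hηdef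
  have hη0 : 0 < η := B9GeoLemma21KLevelV1.geo9K_eta_pos x.toKIdx
  have key := eLatSC_le_of_eBlock G x par ιB C37 C38 hι hB₀ hE 2 f E y' B hE1 hB hoff hbd z
  have hep : epow 2 = 1 := rfl
  have hpref : B9.pref4 ((geo9Y x).len (blkC x.toKIdx ιB z)) 2 = (geo9Y x).len (blkC x.toKIdx ιB z) := rfl
  rw [hep, pow_one, hpref] at key
  set Λ₀ := liftY f E with hΛ₀
  have hF : ∀ μ, diffLetter (shiftY x.toKIdx) (UboxY x.toKIdx U) (((η : ℂ))⁻¹) (Sum.inl μ) Λ₀ = ((η : ℂ))⁻¹ • cdS x.toKIdx U μ Λ₀ := by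
    intro μ; funext w; rw [B9Eq352GradLetters.diffLetter_inl, B9Eq352DivFormLetters.gradLetterF_apply]; rfl
  have hB' : ∀ μ, diffLetter (shiftY x.toKIdx) (UboxY x.toKIdx U) (((η : ℂ))⁻¹) (Sum.inr μ) Λ₀ = -(((η : ℂ))⁻¹ • cdsS x.toKIdx U μ Λ₀) := by
    intro μ; funext w
    rw [B9Eq352GradLetters.diffLetter_inr, LinearMap.neg_apply, Pi.neg_apply, Pi.neg_apply, B9Eq352DivFormLetters.gradLetterB_apply]; rfl
  have hval : ∀ μ, ((((η ^ 2)) • (GpY x.toKIdx par U).restrictScalars ℝ) * diffLetter (shiftY x.toKIdx) (UboxY x.toKIdx U) (((η : ℂ))⁻¹) (Sum.inl μ))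
        Λ₀ z = (η ^ 2 : ℝ) • (((η : ℂ))⁻¹ • GpY x.toKIdx par U (cdS x.toKIdx U μ Λ₀) z) := by
    intro μ
    simp only [Module.End.mul_apply, hF, map_smul, LinearMap.smul_apply, LinearMap.restrictScalars_apply, Pi.smul_apply]
  have hval' : ∀ μ, ((((η ^ 2)) • (GpY x.toKIdx par U).restrictScalars ℝ) * diffLetter (shiftY x.toKIdx) (UboxY x.toKIdx U) (((η : ℂ))⁻¹) (Sum.inr μ))
        Λ₀ z = -((η ^ 2 : ℝ) • (((η : ℂ))⁻¹ • GpY x.toKIdx par U (cdsS x.toKIdx U μ Λ₀) z)) := by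
    intro μ
    simp only [Module.End.mul_apply, hB', map_neg, map_smul, LinearMap.smul_apply, LinearMap.restrictScalars_apply, Pi.neg_apply, Pi.smul_apply]
  have hnorm : ∀ v : 𝔸, ‖(η ^ 2 : ℝ) • (((η : ℂ))⁻¹ • v)‖ = η * ‖v‖ := fun v => by
    rw [norm_smul, norm_smul, norm_inv, Complex.norm_real, Real.norm_eq_abs, Real.norm_eq_abs, abs_of_pos hη0, abs_of_nonneg (by positivity)]
    field_simp
  rcases k with μ | μ
  · rw [hval μ, hnorm]
    have h1 : ‖GpY x.toKIdx par U (cdS x.toKIdx U μ Λ₀) z‖ ≤ eLatSC x.toKIdx (GpY x.toKIdx par) U U Λ₀ (blkY x.toKIdx z) 2 :=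
      (norm_le_supBlkS' x.toKIdx (blkY x.toKIdx z) (fun μ => GpY x.toKIdx par U (cdS x.toKIdx U μ Λ₀)) μ rfl).trans (le_max_left _ _)
    exact (mul_le_mul_of_nonneg_left h1 hη0.le).trans key
  · rw [hval' μ, norm_neg, hnorm]
    have h1 : ‖GpY x.toKIdx par U (cdsS x.toKIdx U μ Λ₀) z‖ ≤ eLatSC x.toKIdx (GpY x.toKIdx par) U U Λ₀ (blkY x.toKIdx z) 2 :=
      (norm_le_supBlkS' x.toKIdx (blkY x.toKIdx z) (fun μ => GpY x.toKIdx par U (cdsS x.toKIdx U μ Λ₀)) μ rfl).trans (le_max_right _ _)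
    exact (mul_le_mul_of_nonneg_left h1 hη0.le).trans key

/-- ★ **ENTRY 3 OF THE READING** (the Laplacian letter): `‖(η⁻²Δ_U·η²G′(U))(f ⊗ E)(z)‖ ≦ B₀e^{−δd}·B`. [cite: Balaban1985BackgroundPropagators, (3.42) p.397 (fourth entry), (3.23) p.394] -/
theorem liftY_bound_three (hι : ∀ s : BlkY x.toKIdx, β x.toKIdx.hN x.toKIdx.D x.toKIdx.hk (ιB s) = s) {U : CfgY 𝔸 x.toKIdx} {B₀ δ : ℝ}
    (hB₀ : 0 ≤ B₀) (hE : EBlock (KSC G x par C37 C38) B₀ δ (.base U))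
    (f : SiteY x.toKIdx → ℝ) (E : 𝔸) (y' : IBondY x.toKIdx) (B : ℝ) (hE1 : ‖E‖ ≤ 1) (hB : 0 ≤ B)
    (hoff : ∀ z, blkC x.toKIdx ιB z ≠ y' → f z = 0) (hbd : ∀ z, |f z| ≤ B) (z : SiteY x.toKIdx) :
    ‖((((kGeo x.toKIdx).eta ^ 2)⁻¹ • (Node00.lapSL x.toKIdx U).restrictScalars ℝ) *
        (((kGeo x.toKIdx).eta ^ 2) • (GpY x.toKIdx par U).restrictScalars ℝ)) (liftY f E) z‖
      ≤ (B₀ * 1 * Real.exp (-(δ * (geo9Y x).dist (blkC x.toKIdx ιB z) y'))) * B := by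
  set η := (kGeo x.toKIdx).eta with hηdef
  have hη0 : 0 < η := B9GeoLemma21KLevelV1.geo9K_eta_pos x.toKIdx
  have hη2 : (η ^ 2 : ℝ) ≠ 0 := pow_ne_zero 2 hη0.ne'
  have key := eLatSC_le_of_eBlock G x par ιB C37 C38 hι hB₀ hE 3 f E y' B hE1 hB hoff hbd z
  have hep : epow 3 = 0 := rfl
  have hpref : B9.pref4 ((geo9Y x).len (blkC x.toKIdx ιB z)) 3 = 1 := rfl
  rw [hep, pow_zero, one_mul, hpref] at key
  set Λ := GpY x.toKIdx par U (liftY f E) with hΛ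
  have hval : ((((η ^ 2))⁻¹ • (Node00.lapSL x.toKIdx U).restrictScalars ℝ) * (((η ^ 2)) • (GpY x.toKIdx par U).restrictScalars ℝ)) (liftY f E) z
      = lapS x.toKIdx U Λ z := by
    rw [Module.End.mul_apply, LinearMap.smul_apply, LinearMap.restrictScalars_apply, LinearMap.smul_apply, LinearMap.restrictScalars_apply,
      real_smul_fun (η ^ 2) (GpY x.toKIdx par U (liftY f E)), LinearMap.map_smul_of_tower, Node00.lapSL_apply, ← hΛ, Pi.smul_apply, Pi.smul_apply,
      ← Complex.coe_smul, smul_smul, ← Complex.ofReal_mul, inv_mul_cancel₀ hη2, Complex.ofReal_one, one_smul]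
  rw [hval]
  have h1 : ‖lapS x.toKIdx U Λ z‖ ≤ eLatSC x.toKIdx (GpY x.toKIdx par) U U (liftY f E) (blkY x.toKIdx z) 3 :=
    norm_le_supBlkS x.toKIdx (blkY x.toKIdx z) (lapS x.toKIdx U Λ) rfl
  exact h1.trans key

end Record



/-! ## §3 ★★ THE READING DICTIONARY `Read342Y` PROVED for the augmented family of record -/

section Read

open Literature.MathematicalPhysics.QuantumFieldTheory.Balaban1983to89.B6KLevelCensusIndexV1 (KIdx kGeo)
open Literature.MathematicalPhysics.QuantumFieldTheory.Balaban1983to89.B6Ineq2142KLevelV1 (β)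
open Literature.MathematicalPhysics.QuantumFieldTheory.Balaban1983to89.B9Thm34Ext (toB6)
open Literature.MathematicalPhysics.QuantumFieldTheory.Balaban1983to89.B9FromB6 (EBlock)
open Literature.MathematicalPhysics.QuantumFieldTheory.Balaban1983to89.B9Eq352GradLetters (diffLetter)
open Literature.MathematicalPhysics.QuantumFieldTheory.Balaban1983to89.B9SectBCodedCarrier (CCfg)
open Literature.MathematicalPhysics.QuantumFieldTheory.Balaban1983to89.B9Eq360DeltaPrimeAY (AfldY blkY)
open Literature.MathematicalPhysics.QuantumFieldTheory.Balaban1983to89.B9PinMembersKLevelV1 (MemberY geo9Y bg9Y)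
open Literature.MathematicalPhysics.QuantumFieldTheory.Balaban1983to89.B9SectBGpLettersY (decY GVal coordC blkC ΔpC GopC LapC letters_base_of_gVal)
open Literature.MathematicalPhysics.QuantumFieldTheory.Balaban1983to89.B9SectBGpFrameCodedY (codingYx Read342Y Write342Y)
open Literature.MathematicalPhysics.QuantumFieldTheory.Balaban1983to89.Node00 (SiteY BlkY IBondY CfgY BallY SiteOpY SiteParY UboxY shiftY GpY)

variable {d ℓ : ℕ} {hd : 1 ≤ d + 1} {hL : Odd (ℓ + 1) ∧ 1 < ℓ + 1} {b₀ b₁ : ℝ} {Mstar : ℕ} [CompleteSpace 𝔸] [FiniteDimensional ℝ 𝔸]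
  (G : Subgroup 𝔸ˣ) (x : MemberY d ℓ hd hL b₀ b₁ Mstar) (par : SiteParY 𝔸 x.toKIdx) {ι : Type} [Fintype ι] (b : Module.Basis ι ℝ 𝔸)
  (ιB : BlkY x.toKIdx → IBondY x.toKIdx) [Fintype (geo9Y x).Site] (C37 C38 : ℝ → CfgY 𝔸 x.toKIdx → AfldY 𝔸 x.toKIdx → Prop)

/-- ★★ **THE (3.42) READING DICTIONARY OF THE ROOT FRAME, PROVED** for the augmented coded readings `KSC` of NODE 00's G′ (reading constant `c_R = M₂·Σ_j‖b_j‖`):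
the hypothesis `hread` of `B9SectBGpFrameCodedY.gpFrame₂Coded` at `KC := KSC G x par C37 C38`.
[cite: Balaban1985BackgroundPropagators, (3.42) p.397, (3.39) p.397; Balaban1984PropagatorsII, (2.51) p.232] -/
theorem read342Y_KSC (hι : ∀ s : BlkY x.toKIdx, β x.toKIdx.hN x.toKIdx.D x.toKIdx.hk (ιB s) = s)
    (M₂ : ℝ) (hM₂ : 0 ≤ M₂) (hrepr : ∀ (v : 𝔸) (j : ι), |b.repr v j| ≤ M₂ * ‖v‖) (c35 MInv aInv : ℝ) :
    Read342Y G x par b ιB C37 C38 (KSC G x par C37 C38) c35 (M₂ * ∑ j, ‖b j‖) MInv aInv 0 True := by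
  intro α₀ U B₀ δ _ _ _ hreg hB₀ _ hE
  have hU : GVal G x.toKIdx U := hreg.1.1
  have hco : coordC G x.toKIdx (.base U) = UboxY x.toKIdx U := (letters_base_of_gVal G x.toKIdx par hU).1
  set η := (kGeo x.toKIdx).eta with hηdef
  have hGop : GopC x.toKIdx par b (.base U) = conj b ((η ^ 2) • (GpY x.toKIdx par U).restrictScalars ℝ) := rfl
  have hLap : LapC x.toKIdx b (.base U) = conj b ((η ^ 2)⁻¹ • (Node00.lapSL x.toKIdx U).restrictScalars ℝ) := rfl
  refine ⟨?_, fun k => ?_, fun k => ?_, ?_⟩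
  · have h := hasMajorant_conj_of_liftY_bound b (g := toB6 (geo9Y x) 0 True) (fun z => blkC x.toKIdx ιB z)
      ((η ^ 2) • (GpY x.toKIdx par U).restrictScalars ℝ)
      (fun a a' => B₀ * (geo9Y x).len a ^ 2 * Real.exp (-(δ * (geo9Y x).dist a a'))) M₂ hM₂ hrepr
      (fun f E y' B hE1 hB hoff hbd z => liftY_bound_zero G x par ιB C37 C38 hι hB₀.le hE f E y' B hE1 hB hoff hbd z)
    rw [hGop]
    intro y' μ B hμ p
    exact (h y' μ B hμ p).trans (le_of_eq (by ring))
  · have h := hasMajorant_conj_of_liftY_bound b (g := toB6 (geo9Y x) 0 True) (fun z => blkC x.toKIdx ιB z)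
      (diffLetter (shiftY x.toKIdx) (UboxY x.toKIdx U) (((η : ℂ))⁻¹) k * ((η ^ 2) • (GpY x.toKIdx par U).restrictScalars ℝ))
      (fun a a' => B₀ * (geo9Y x).len a * Real.exp (-(δ * (geo9Y x).dist a a'))) M₂ hM₂ hrepr
      (fun f E y' B hE1 hB hoff hbd z => liftY_bound_one G x par ιB C37 C38 hι hB₀.le hE k f E y' B hE1 hB hoff hbd z)
    rw [hco, hGop, ← B9Eq352DivFormLetters.conj_mul]
    intro y' μ B hμ p
    exact (h y' μ B hμ p).trans (le_of_eq (by ring))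
  · have h := hasMajorant_conj_of_liftY_bound b (g := toB6 (geo9Y x) 0 True) (fun z => blkC x.toKIdx ιB z)
      (((η ^ 2) • (GpY x.toKIdx par U).restrictScalars ℝ) * diffLetter (shiftY x.toKIdx) (UboxY x.toKIdx U) (((η : ℂ))⁻¹) k)
      (fun a a' => B₀ * (geo9Y x).len a * Real.exp (-(δ * (geo9Y x).dist a a'))) M₂ hM₂ hrepr
      (fun f E y' B hE1 hB hoff hbd z => liftY_bound_two G x par ιB C37 C38 hι hB₀.le hE k f E y' B hE1 hB hoff hbd z)
    rw [hco, hGop, ← B9Eq352DivFormLetters.conj_mul]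
    intro y' μ B hμ p
    exact (h y' μ B hμ p).trans (le_of_eq (by ring))
  · have h := hasMajorant_conj_of_liftY_bound b (g := toB6 (geo9Y x) 0 True) (fun z => blkC x.toKIdx ιB z)
      ((((η ^ 2))⁻¹ • (Node00.lapSL x.toKIdx U).restrictScalars ℝ) * ((η ^ 2) • (GpY x.toKIdx par U).restrictScalars ℝ))
      (fun a a' => B₀ * 1 * Real.exp (-(δ * (geo9Y x).dist a a'))) M₂ hM₂ hrepr
      (fun f E y' B hE1 hB hoff hbd z => liftY_bound_three G x par ιB C37 C38 hι hB₀.le hE f E y' B hE1 hB hoff hbd z)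
    rw [hLap, hGop, ← B9Eq352DivFormLetters.conj_mul]
    intro y' μ B hμ p
    exact (h y' μ B hμ p).trans (le_of_eq (by ring))

end Read

/-! ## §4 ★★ THE WRITING DICTIONARY `Write342Y` PROVED for the augmented family of record -/

section Write

open Literature.MathematicalPhysics.QuantumFieldTheory.Balaban1983to89.B6KLevelCensusIndexV1 (KIdx kGeo)
open Literature.MathematicalPhysics.QuantumFieldTheory.Balaban1983to89.B6Ineq2142KLevelV1 (β lvl beta_level)
open Literature.MathematicalPhysics.QuantumFieldTheory.Balaban1983to89.B6Prop22KLevelCensusEta (epow)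
open Literature.MathematicalPhysics.QuantumFieldTheory.Balaban1983to89.B9Thm34Ext (toB6)
open Literature.MathematicalPhysics.QuantumFieldTheory.Balaban1983to89.B9FromB6 (EBlock)
open Literature.MathematicalPhysics.QuantumFieldTheory.Balaban1983to89.B9Eq39Adjoint (fluct)
open Literature.MathematicalPhysics.QuantumFieldTheory.Balaban1983to89.B9Eq352GradLetters (diffLetter)
open Literature.MathematicalPhysics.QuantumFieldTheory.Balaban1983to89.B9SectBCodedCarrier (CCfg)
open Literature.MathematicalPhysics.QuantumFieldTheory.Balaban1983to89.B9Eq360DeltaPrimeAY (AfldY blkY blkY_apply mulY)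
open Literature.MathematicalPhysics.QuantumFieldTheory.Balaban1983to89.B9PinMembersKLevelV1 (MemberY geo9Y bg9Y)
open Literature.MathematicalPhysics.QuantumFieldTheory.Balaban1983to89.B9SectBGpLettersY (decY GVal coordC blkC ΔpC GopC LapC letters_base_of_gVal)
open Literature.MathematicalPhysics.QuantumFieldTheory.Balaban1983to89.B9SectBGpFrameCodedY (codingYx Read342Y Write342Y)
open Literature.MathematicalPhysics.QuantumFieldTheory.Balaban1983to89.Node00 (SiteY BlkY IBondY CfgY BallY SiteOpY SiteParY UboxY shiftY cdS cdsS lapS etaS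
  supBlkS supBlkS' GpY)

variable {d ℓ : ℕ} {hd : 1 ≤ d + 1} {hL : Odd (ℓ + 1) ∧ 1 < ℓ + 1} {b₀ b₁ : ℝ} {Mstar : ℕ} [CompleteSpace 𝔸] [FiniteDimensional ℝ 𝔸]
  (G : Subgroup 𝔸ˣ) (x : MemberY d ℓ hd hL b₀ b₁ Mstar) (par : SiteParY 𝔸 x.toKIdx) {ι : Type} [Fintype ι] (b : Module.Basis ι ℝ 𝔸)
  (ιB : BlkY x.toKIdx → IBondY x.toKIdx) (C37 C38 : ℝ → CfgY 𝔸 x.toKIdx → AfldY 𝔸 x.toKIdx → Prop)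

omit [CompleteSpace 𝔸] [FiniteDimensional ℝ 𝔸] in
/-- the label of the genuine block of an index bond has that bond's scale length. [cite: Balaban1985BackgroundPropagators, (3.41) p.397 («Lʲη»), bookkeeping] -/
theorem len_label (hι : ∀ s : BlkY x.toKIdx, β x.toKIdx.hN x.toKIdx.D x.toKIdx.hk (ιB s) = s) (y : IBondY x.toKIdx) :
    (geo9Y x).len (ιB (β x.toKIdx.hN x.toKIdx.D x.toKIdx.hk y)) = (geo9Y x).len y := by
  have hk1 : 1 ≤ x.k := le_trans one_le_two x.hk2
  show (kGeo x.toKIdx).L ^ lvl x.toKIdx.hN x.toKIdx.D x.toKIdx.hk _ * (kGeo x.toKIdx).eta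
    = (kGeo x.toKIdx).L ^ lvl x.toKIdx.hN x.toKIdx.D x.toKIdx.hk y * (kGeo x.toKIdx).eta
  rw [← beta_level x.toKIdx.hN x.toKIdx.D x.toKIdx.hk hk1, hι, beta_level x.toKIdx.hN x.toKIdx.D x.toKIdx.hk hk1]

omit [CompleteSpace 𝔸] [FiniteDimensional ℝ 𝔸] in
/-- the labels of two genuine blocks are at the distance of the bonds. [cite: Balaban1984PropagatorsII, (2.46) p.231, bookkeeping] -/
theorem dist_label (hι : ∀ s : BlkY x.toKIdx, β x.toKIdx.hN x.toKIdx.D x.toKIdx.hk (ιB s) = s) (y y' : IBondY x.toKIdx) :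
    (geo9Y x).dist (ιB (β x.toKIdx.hN x.toKIdx.D x.toKIdx.hk y)) (ιB (β x.toKIdx.hN x.toKIdx.D x.toKIdx.hk y')) = (geo9Y x).dist y y' := by
  show (B6Geom246MultiLevelTorus.geomT x.toKIdx.D).dist (β x.toKIdx.hN x.toKIdx.D x.toKIdx.hk _) (β x.toKIdx.hN x.toKIdx.D x.toKIdx.hk _)
    = (B6Geom246MultiLevelTorus.geomT x.toKIdx.D).dist (β x.toKIdx.hN x.toKIdx.D x.toKIdx.hk y) (β x.toKIdx.hN x.toKIdx.D x.toKIdx.hk y')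
  rw [hι, hι]

omit [FiniteDimensional ℝ 𝔸] in
/-- a support in the genuine block `β y′` (the reading's «supp λ ⊂ Δ(y′)») is a support in the labelled block `ιB (β y′)` of the frame.
[cite: Balaban1985BackgroundPropagators, (3.42) p.397, bookkeeping] -/
theorem off_of_suppIn_inl {f : SiteY x.toKIdx → ℝ} {y' : IBondY x.toKIdx} (h : (geo9Y x).suppIn (.inl f) y') (z : SiteY x.toKIdx)
    (hz : blkC x.toKIdx ιB z ≠ ιB (β x.toKIdx.hN x.toKIdx.D x.toKIdx.hk y')) : f z = 0 := by
  by_contra hne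
  exact hz (by rw [blkC, show blkY x.toKIdx z = _ from h z hne])

omit [CompleteSpace 𝔸] [FiniteDimensional ℝ 𝔸] in
/-- the values of a scalar site function are below the reading's `|λ|`. [cite: Balaban1985BackgroundPropagators, (3.39) p.397, bookkeeping] -/
theorem abs_le_supNorm_inl (f : SiteY x.toKIdx → ℝ) (z : SiteY x.toKIdx) : |f z| ≤ (geo9Y x).supNorm (.inl f) :=
  le_ciSup (f := fun w : SiteY x.toKIdx => |f w|) (Set.finite_range _).bddAbove z

omit [CompleteSpace 𝔸] [FiniteDimensional ℝ 𝔸] in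
/-- the reading's `|λ|` is nonnegative (both summands). [cite: Balaban1985BackgroundPropagators, (3.39) p.397, bookkeeping] -/
theorem supNorm_nonneg (lam : (geo9Y x).Loc) : 0 ≤ (geo9Y x).supNorm lam :=
  B9GeoNormsKLevelV1.geo9K_supNorm_nonneg x.toKIdx lam

omit [FiniteDimensional ℝ 𝔸] in
/-- the value identities of the four letter products on an input `Λ₀` at `z`, letters at the base `U₀`, operator at `V` (norms). [cite: Balaban1985BackgroundPropagators, (3.42) p.397, (3.3) p.390, (3.8) p.392, (3.23) p.394, bookkeeping] -/
theorem norm_letters (U₀ V : CfgY 𝔸 x.toKIdx) (Λ₀ : SiteY x.toKIdx → 𝔸) (z : SiteY x.toKIdx) (μ : Fin (d + 1)) :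
    ‖((((kGeo x.toKIdx).eta ^ 2)) • (GpY x.toKIdx par V).restrictScalars ℝ) Λ₀ z‖ = (kGeo x.toKIdx).eta ^ 2 * ‖GpY x.toKIdx par V Λ₀ z‖ ∧
    ‖(diffLetter (shiftY x.toKIdx) (UboxY x.toKIdx U₀) ((((geo9Y x).eta : ℂ))⁻¹) (Sum.inl μ) *
        (((kGeo x.toKIdx).eta ^ 2) • (GpY x.toKIdx par V).restrictScalars ℝ)) Λ₀ z‖ = (kGeo x.toKIdx).eta * ‖cdS x.toKIdx U₀ μ (GpY x.toKIdx par V Λ₀) z‖ ∧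
    ‖(diffLetter (shiftY x.toKIdx) (UboxY x.toKIdx U₀) ((((geo9Y x).eta : ℂ))⁻¹) (Sum.inr μ) *
        (((kGeo x.toKIdx).eta ^ 2) • (GpY x.toKIdx par V).restrictScalars ℝ)) Λ₀ z‖ = (kGeo x.toKIdx).eta * ‖cdsS x.toKIdx U₀ μ (GpY x.toKIdx par V Λ₀) z‖ ∧
    ‖((((kGeo x.toKIdx).eta ^ 2) • (GpY x.toKIdx par V).restrictScalars ℝ) *
        diffLetter (shiftY x.toKIdx) (UboxY x.toKIdx U₀) ((((geo9Y x).eta : ℂ))⁻¹) (Sum.inl μ)) Λ₀ z‖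
      = (kGeo x.toKIdx).eta * ‖GpY x.toKIdx par V (cdS x.toKIdx U₀ μ Λ₀) z‖ ∧
    ‖((((kGeo x.toKIdx).eta ^ 2) • (GpY x.toKIdx par V).restrictScalars ℝ) *
        diffLetter (shiftY x.toKIdx) (UboxY x.toKIdx U₀) ((((geo9Y x).eta : ℂ))⁻¹) (Sum.inr μ)) Λ₀ z‖
      = (kGeo x.toKIdx).eta * ‖GpY x.toKIdx par V (cdsS x.toKIdx U₀ μ Λ₀) z‖ ∧
    ‖((((kGeo x.toKIdx).eta ^ 2)⁻¹ • (Node00.lapSL x.toKIdx U₀).restrictScalars ℝ) *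
        (((kGeo x.toKIdx).eta ^ 2) • (GpY x.toKIdx par V).restrictScalars ℝ)) Λ₀ z‖ = ‖lapS x.toKIdx U₀ (GpY x.toKIdx par V Λ₀) z‖ := by
  set η := (kGeo x.toKIdx).eta with hηdef
  rw [show (geo9Y x).eta = η from rfl]
  have hη0 : 0 < η := B9GeoLemma21KLevelV1.geo9K_eta_pos x.toKIdx
  have hη2 : (η ^ 2 : ℝ) ≠ 0 := pow_ne_zero 2 hη0.ne'
  have hn1 : ∀ v : 𝔸, ‖((η : ℂ))⁻¹ • ((((η ^ 2 : ℝ)) : ℂ) • v)‖ = η * ‖v‖ := fun v => by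
    rw [norm_smul, norm_smul, norm_inv, Complex.norm_real, Complex.norm_real, Real.norm_eq_abs, Real.norm_eq_abs, abs_of_pos hη0,
      abs_of_nonneg (by positivity)]
    field_simp
  have hn2 : ∀ v : 𝔸, ‖(η ^ 2 : ℝ) • (((η : ℂ))⁻¹ • v)‖ = η * ‖v‖ := fun v => by
    rw [norm_smul, norm_smul, norm_inv, Complex.norm_real, Real.norm_eq_abs, Real.norm_eq_abs, abs_of_pos hη0, abs_of_nonneg (by positivity)]
    field_simp
  have hF : diffLetter (shiftY x.toKIdx) (UboxY x.toKIdx U₀) (((η : ℂ))⁻¹) (Sum.inl μ) Λ₀ = ((η : ℂ))⁻¹ • cdS x.toKIdx U₀ μ Λ₀ := by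
    funext w; rw [B9Eq352GradLetters.diffLetter_inl, B9Eq352DivFormLetters.gradLetterF_apply]; rfl
  have hB' : diffLetter (shiftY x.toKIdx) (UboxY x.toKIdx U₀) (((η : ℂ))⁻¹) (Sum.inr μ) Λ₀ = -(((η : ℂ))⁻¹ • cdsS x.toKIdx U₀ μ Λ₀) := by
    funext w
    rw [B9Eq352GradLetters.diffLetter_inr, LinearMap.neg_apply, Pi.neg_apply, Pi.neg_apply, B9Eq352DivFormLetters.gradLetterB_apply]; rfl
  refine ⟨?_, ?_, ?_, ?_, ?_, ?_⟩
  · rw [LinearMap.smul_apply, LinearMap.restrictScalars_apply, Pi.smul_apply, norm_smul, Real.norm_eq_abs, abs_of_nonneg (by positivity)]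
  · rw [Module.End.mul_apply, B9Eq352GradLetters.diffLetter_inl, B9Eq352DivFormLetters.gradLetterF_apply, LinearMap.smul_apply,
      LinearMap.restrictScalars_apply, real_smul_fun, B9Eq39Adjoint.covD_smul]
    exact hn1 _
  · rw [Module.End.mul_apply, B9Eq352GradLetters.diffLetter_inr, LinearMap.neg_apply, Pi.neg_apply, B9Eq352DivFormLetters.gradLetterB_apply,
      LinearMap.smul_apply, LinearMap.restrictScalars_apply, real_smul_fun, B9Eq39Adjoint.covDstar_smul, norm_neg]
    exact hn1 _
  · simp only [Module.End.mul_apply, hF, map_smul, LinearMap.smul_apply, LinearMap.restrictScalars_apply, Pi.smul_apply]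
    exact hn2 _
  · simp only [Module.End.mul_apply, hB', map_neg, map_smul, LinearMap.smul_apply, LinearMap.restrictScalars_apply, Pi.neg_apply, Pi.smul_apply,
      norm_neg]
    exact hn2 _
  · rw [Module.End.mul_apply, LinearMap.smul_apply, LinearMap.restrictScalars_apply, LinearMap.smul_apply, LinearMap.restrictScalars_apply,
      real_smul_fun (η ^ 2) (GpY x.toKIdx par V Λ₀), LinearMap.map_smul_of_tower, Node00.lapSL_apply, Pi.smul_apply, Pi.smul_apply,
      ← Complex.coe_smul, smul_smul, ← Complex.ofReal_mul, inv_mul_cancel₀ hη2, Complex.ofReal_one, one_smul]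

variable [Fintype (geo9Y x).Site]

omit [FiniteDimensional ℝ 𝔸] in
/-- ★★ **THE (3.42) WRITING DICTIONARY OF THE ROOT FRAME, PROVED** for the augmented coded readings `KSC` of NODE 00's G′ (writing functions
`w_B(B,δ) = (M₂Σ_j‖b_j‖)·B + 1`, `w_δ(δ) = δ`; any `a_W`): the hypothesis `hwrite` of `B9SectBGpFrameCodedY.gpFrame₂Coded` at `KC := KSC G x par C37 C38`.
The differences and the Laplacian of the reading at the coded product `prod U a` are taken AT THE BASE `U`, as the frame's letters are.
[cite: Balaban1985BackgroundPropagators, (3.42) p.397, p.403 («of course with different constants»); Balaban1984PropagatorsII, (2.51) p.232] -/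
theorem write342Y_KSC (hι : ∀ s : BlkY x.toKIdx, β x.toKIdx.hN x.toKIdx.D x.toKIdx.hk (ιB s) = s)
    (M₂ : ℝ) (hM₂ : 0 ≤ M₂) (hrepr : ∀ (v : 𝔸) (j : ι), |b.repr v j| ≤ M₂ * ‖v‖) (aW : ℝ)
    (hC37 : ∀ β U a, C37 β U a → GVal G x.toKIdx U) :
    Write342Y G x par b ιB C37 C38 (KSC G x par C37 C38) (fun B _ => (M₂ * ∑ j, ‖b j‖) * B + 1) (fun δ => δ) aW 0 True := by
  intro U a α₁ B δ _ _ h37 hB hδ hG hDG hGD hLG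
  have hU : GVal G x.toKIdx U := hC37 α₁ U a h37
  have hco : coordC G x.toKIdx (.base U) = UboxY x.toKIdx U := (letters_base_of_gVal G x.toKIdx par hU).1
  set η := (kGeo x.toKIdx).eta with hηdef
  have hη0 : 0 < η := B9GeoLemma21KLevelV1.geo9K_eta_pos x.toKIdx
  set c₀ : ℝ := M₂ * ∑ j, ‖b j‖ with hc₀
  have hc₀0 : 0 ≤ c₀ := mul_nonneg hM₂ (Finset.sum_nonneg fun j _ => norm_nonneg _)
  set V := mulY x.toKIdx (fluct (kGeo x.toKIdx).eta a) U with hV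
  have hGop : GopC x.toKIdx par b (.prod U a) = conj b ((η ^ 2) • (GpY x.toKIdx par V).restrictScalars ℝ) := rfl
  have hLap : LapC x.toKIdx b (.base U) = conj b ((η ^ 2)⁻¹ • (Node00.lapSL x.toKIdx U).restrictScalars ℝ) := rfl
  rw [hco] at hDG hGD
  rw [hGop] at hG hDG hGD hLG
  rw [hLap] at hLG
  intro n lam y y' hsupp
  have hlen : 0 ≤ (geo9Y x).len y := (B9GeoLemma21KLevelV1.geo9Y_len_pos x y).le
  have hp : 0 ≤ B9.pref4 ((geo9Y x).len y) n := by
    match n with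
    | 0 => exact pow_nonneg hlen 2
    | 1 => exact hlen
    | 2 => exact hlen
    | 3 => exact zero_le_one
  have hRHS : 0 ≤ (c₀ * B + 1) * B9.pref4 ((geo9Y x).len y) n * Real.exp (-(δ * (geo9Y x).dist y y')) * (geo9Y x).supNorm lam := by
    have := supNorm_nonneg x lam
    positivity
  cases lam with
  | inr J => rw [KSC, kernelFamilySC_e_inr]; exact hRHS
  | inl f =>
    set B' := (geo9Y x).supNorm (.inl f) with hB'
    have hB'0 : 0 ≤ B' := supNorm_nonneg x (.inl f)
    have hbd : ∀ w, |f w| ≤ B' := abs_le_supNorm_inl x f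
    have hoff : ∀ w, blkC x.toKIdx ιB w ≠ ιB (β x.toKIdx.hN x.toKIdx.D x.toKIdx.hk y') → f w = 0 := off_of_suppIn_inl x ιB hsupp
    have hlab : ∀ w, B6Geom246MultiLevelBox.blkOf x.toKIdx.D.toDomains w = β x.toKIdx.hN x.toKIdx.D x.toKIdx.hk y →
        blkC x.toKIdx ιB w = ιB (β x.toKIdx.hN x.toKIdx.D x.toKIdx.hk y) := fun w hw => by rw [blkC, blkY_apply, hw]
    set ex := Real.exp (-(δ * (geo9Y x).dist y y')) with hex
    have hex0 : 0 ≤ ex := (Real.exp_pos _).le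
    rw [KSC, kernelFamilySC_e_inl, etaS_eq_eta x]
    show η ^ (epow n) * (⨆ E : BallY 𝔸, eLatSC x.toKIdx (GpY x.toKIdx par) U V (liftY f (E : 𝔸)) (β x.toKIdx.hN x.toKIdx.D x.toKIdx.hk y) n)
      ≤ (c₀ * B + 1) * B9.pref4 ((geo9Y x).len y) n * ex * B'
    -- the pointwise bounds at a direction `E` of the ball and a site `w` of the block `y`
    have pw : ∀ (E : BallY 𝔸) (w : SiteY x.toKIdx), B6Geom246MultiLevelBox.blkOf x.toKIdx.D.toDomains w = β x.toKIdx.hN x.toKIdx.D x.toKIdx.hk y →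
        η ^ 2 * ‖GpY x.toKIdx par V (liftY f (E : 𝔸)) w‖ ≤ c₀ * (B * (geo9Y x).len y ^ 2 * ex) * B' ∧
        (∀ μ, η * ‖cdS x.toKIdx U μ (GpY x.toKIdx par V (liftY f (E : 𝔸))) w‖ ≤ c₀ * (B * (geo9Y x).len y * ex) * B') ∧
        (∀ μ, η * ‖cdsS x.toKIdx U μ (GpY x.toKIdx par V (liftY f (E : 𝔸))) w‖ ≤ c₀ * (B * (geo9Y x).len y * ex) * B') ∧
        (∀ μ, η * ‖GpY x.toKIdx par V (cdS x.toKIdx U μ (liftY f (E : 𝔸))) w‖ ≤ c₀ * (B * (geo9Y x).len y * ex) * B') ∧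
        (∀ μ, η * ‖GpY x.toKIdx par V (cdsS x.toKIdx U μ (liftY f (E : 𝔸))) w‖ ≤ c₀ * (B * (geo9Y x).len y * ex) * B') ∧
        ‖lapS x.toKIdx U (GpY x.toKIdx par V (liftY f (E : 𝔸))) w‖ ≤ c₀ * (B * 1 * ex) * B' := by
      intro E w hw
      have hE1 : ‖(E : 𝔸)‖ ≤ 1 := mem_closedBall_zero_iff.1 E.2
      have hL := norm_letters x par U V (liftY f (E : 𝔸)) w
      have W := fun (T : Module.End ℝ (SiteY x.toKIdx → 𝔸)) (K : IBondY x.toKIdx → IBondY x.toKIdx → ℝ)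
        (h : HasMajorant (g := toB6 (geo9Y x) 0 True) (fun p : SiteY x.toKIdx × ι => blkC x.toKIdx ιB p.1) (conj b T) K) =>
        liftY_bound_of_hasMajorant_conj b (g := toB6 (geo9Y x) 0 True) (fun z => blkC x.toKIdx ιB z) T K M₂ hM₂ hrepr h f (E : 𝔸)
          (ιB (β x.toKIdx.hN x.toKIdx.D x.toKIdx.hk y')) B' hE1 hB'0 hoff hbd w
      refine ⟨?_, fun μ => ?_, fun μ => ?_, fun μ => ?_, fun μ => ?_, ?_⟩
      · have h := W _ _ hG
        rw [(hL 0).1, hlab w hw, len_label x ιB hι, dist_label x ιB hι] at h; exact h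
      · have h := W _ _ (by rw [B9Eq352DivFormLetters.conj_mul]; exact hDG (Sum.inl μ))
        rw [(hL μ).2.1, hlab w hw, len_label x ιB hι, dist_label x ιB hι] at h; exact h
      · have h := W _ _ (by rw [B9Eq352DivFormLetters.conj_mul]; exact hDG (Sum.inr μ))
        rw [(hL μ).2.2.1, hlab w hw, len_label x ιB hι, dist_label x ιB hι] at h; exact h
      · have h := W _ _ (by rw [B9Eq352DivFormLetters.conj_mul]; exact hGD (Sum.inl μ))
        rw [(hL μ).2.2.2.1, hlab w hw, len_label x ιB hι, dist_label x ιB hι] at h; exact h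
      · have h := W _ _ (by rw [B9Eq352DivFormLetters.conj_mul]; exact hGD (Sum.inr μ))
        rw [(hL μ).2.2.2.2.1, hlab w hw, len_label x ιB hι, dist_label x ιB hι] at h; exact h
      · have h := W _ _ (by rw [B9Eq352DivFormLetters.conj_mul]; exact hLG)
        rw [(hL 0).2.2.2.2.2, hlab w hw, dist_label x ιB hι] at h; exact h
    -- the bound of every direction, per entry
    have hdir : ∀ E : BallY 𝔸, η ^ (epow n) * eLatSC x.toKIdx (GpY x.toKIdx par) U V (liftY f (E : 𝔸)) (β x.toKIdx.hN x.toKIdx.D x.toKIdx.hk y) n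
        ≤ c₀ * B * B9.pref4 ((geo9Y x).len y) n * ex * B' := by
      intro E
      set Λ₀ := liftY f (E : 𝔸) with hΛ₀
      set s₀ := β x.toKIdx.hN x.toKIdx.D x.toKIdx.hk y with hs₀
      match n with
      | 0 =>
        show η ^ 2 * supBlkS x.toKIdx s₀ (GpY x.toKIdx par V Λ₀) ≤ c₀ * B * ((geo9Y x).len y ^ 2) * ex * B'
        have hC : 0 ≤ c₀ * B * ((geo9Y x).len y ^ 2) * ex * B' / η ^ 2 := by positivity
        have hs : supBlkS x.toKIdx s₀ (GpY x.toKIdx par V Λ₀) ≤ c₀ * B * ((geo9Y x).len y ^ 2) * ex * B' / η ^ 2 :=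
          B9Ineq349SiteComposite.supBlkS_le x.toKIdx _ _ hC fun w hw => by
            rw [le_div_iff₀ (by positivity), mul_comm]; exact ((pw E w hw).1).trans (le_of_eq (by ring))
        calc η ^ 2 * supBlkS x.toKIdx s₀ (GpY x.toKIdx par V Λ₀) ≤ η ^ 2 * (c₀ * B * ((geo9Y x).len y ^ 2) * ex * B' / η ^ 2) :=
              mul_le_mul_of_nonneg_left hs (by positivity)
          _ = _ := mul_div_cancel₀ _ (by positivity)
      | 1 =>
        show η ^ 1 * max (supBlkS' x.toKIdx s₀ (fun μ => cdS x.toKIdx U μ (GpY x.toKIdx par V Λ₀)))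
            (supBlkS' x.toKIdx s₀ (fun μ => cdsS x.toKIdx U μ (GpY x.toKIdx par V Λ₀))) ≤ c₀ * B * (geo9Y x).len y * ex * B'
        rw [pow_one]
        have hC : 0 ≤ c₀ * B * (geo9Y x).len y * ex * B' / η := by positivity
        have hs : max (supBlkS' x.toKIdx s₀ (fun μ => cdS x.toKIdx U μ (GpY x.toKIdx par V Λ₀)))
            (supBlkS' x.toKIdx s₀ (fun μ => cdsS x.toKIdx U μ (GpY x.toKIdx par V Λ₀))) ≤ c₀ * B * (geo9Y x).len y * ex * B' / η :=
          max_le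
            (B9Ineq349SiteComposite.supBlkS'_le x.toKIdx _ _ hC fun w μ hw => by
              rw [le_div_iff₀ hη0, mul_comm]; exact ((pw E w hw).2.1 μ).trans (le_of_eq (by ring)))
            (B9Ineq349SiteComposite.supBlkS'_le x.toKIdx _ _ hC fun w μ hw => by
              rw [le_div_iff₀ hη0, mul_comm]; exact ((pw E w hw).2.2.1 μ).trans (le_of_eq (by ring)))
        calc η * max _ _ ≤ η * (c₀ * B * (geo9Y x).len y * ex * B' / η) := mul_le_mul_of_nonneg_left hs hη0.le
          _ = _ := mul_div_cancel₀ _ hη0.ne'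
      | 2 =>
        show η ^ 1 * max (supBlkS' x.toKIdx s₀ (fun μ => GpY x.toKIdx par V (cdS x.toKIdx U μ Λ₀)))
            (supBlkS' x.toKIdx s₀ (fun μ => GpY x.toKIdx par V (cdsS x.toKIdx U μ Λ₀))) ≤ c₀ * B * (geo9Y x).len y * ex * B'
        rw [pow_one]
        have hC : 0 ≤ c₀ * B * (geo9Y x).len y * ex * B' / η := by positivity
        have hs : max (supBlkS' x.toKIdx s₀ (fun μ => GpY x.toKIdx par V (cdS x.toKIdx U μ Λ₀)))
            (supBlkS' x.toKIdx s₀ (fun μ => GpY x.toKIdx par V (cdsS x.toKIdx U μ Λ₀))) ≤ c₀ * B * (geo9Y x).len y * ex * B' / η :=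
          max_le
            (B9Ineq349SiteComposite.supBlkS'_le x.toKIdx _ _ hC fun w μ hw => by
              rw [le_div_iff₀ hη0, mul_comm]; exact ((pw E w hw).2.2.2.1 μ).trans (le_of_eq (by ring)))
            (B9Ineq349SiteComposite.supBlkS'_le x.toKIdx _ _ hC fun w μ hw => by
              rw [le_div_iff₀ hη0, mul_comm]; exact ((pw E w hw).2.2.2.2.1 μ).trans (le_of_eq (by ring)))
        calc η * max _ _ ≤ η * (c₀ * B * (geo9Y x).len y * ex * B' / η) := mul_le_mul_of_nonneg_left hs hη0.le
          _ = _ := mul_div_cancel₀ _ hη0.ne'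
      | 3 =>
        show η ^ 0 * supBlkS x.toKIdx s₀ (lapS x.toKIdx U (GpY x.toKIdx par V Λ₀)) ≤ c₀ * B * 1 * ex * B'
        rw [pow_zero, one_mul]
        exact B9Ineq349SiteComposite.supBlkS_le x.toKIdx _ _ (by positivity) fun w hw => ((pw E w hw).2.2.2.2.2).trans (le_of_eq (by ring))
    have hsup : (⨆ E : BallY 𝔸, eLatSC x.toKIdx (GpY x.toKIdx par) U V (liftY f (E : 𝔸)) (β x.toKIdx.hN x.toKIdx.D x.toKIdx.hk y) n)
        ≤ c₀ * B * B9.pref4 ((geo9Y x).len y) n * ex * B' / η ^ (epow n) := by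
      have hηn : 0 < η ^ (epow n) := pow_pos hη0 _
      exact Node00.iSup_ball_le (fun E => by rw [le_div_iff₀ hηn, mul_comm]; exact hdir E) (by positivity)
    have hηn : 0 < η ^ (epow n) := pow_pos hη0 _
    calc η ^ (epow n) * (⨆ E : BallY 𝔸, eLatSC x.toKIdx (GpY x.toKIdx par) U V (liftY f (E : 𝔸)) (β x.toKIdx.hN x.toKIdx.D x.toKIdx.hk y) n)
        ≤ η ^ (epow n) * (c₀ * B * B9.pref4 ((geo9Y x).len y) n * ex * B' / η ^ (epow n)) := mul_le_mul_of_nonneg_left hsup hηn.le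
      _ = c₀ * B * B9.pref4 ((geo9Y x).len y) n * ex * B' := mul_div_cancel₀ _ hηn.ne'
      _ ≤ (c₀ * B + 1) * B9.pref4 ((geo9Y x).len y) n * ex * B' := by
          have : 0 ≤ B9.pref4 ((geo9Y x).len y) n * ex * B' := by positivity
          nlinarith

end Write

end Literature.MathematicalPhysics.QuantumFieldTheory.Balaban1983to89.B9SectBGpReadingsY
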